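import Summits.AtomisticToContinuum.HydrodynamicLimit.Theses.TwoClocks
import Literature.MathematicalPhysics.KineticTheory.HardSphereEulerProofs
import Literature.MathematicalPhysics.KineticTheory.HardSphereEulerDim
import Literature.MathematicalPhysics.KineticTheory.HardSphereEulerLLN
import Literature.Analysis.FluidPDE.HardSphereAlexander

/-!
# Disproof workfile for the crux `CollisionActivityTails` (stmt-AtomisticToContinuum-13734)

Route decl: `Summit.AtomisticToContinuum.HydrodynamicLimit.Theses.TwoClocks.CollisionActivityTails`
(crux #7 of route TwoClocks, shared by OneFlightGossipEngine's rev-7 re-dock).  Standing adversary: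
refuter-cdisprove-stmt-AtomisticToContinuum-13734-0, cycle 1 (2026-08-16) · gen 2
(refuter-cdisprove-stmt-AtomisticToContinuum-13734-g2-0), cycle 2 (2026-08-16T13:30Z–): §7.
Prose lives in docstrings; the file is sorry-free (`lean check` rc 0, 0 warnings, 0 sorries).

LANDED negative knowledge (importable): `Theorems/CollisionActivityTails/Negative/EquilibriumReduction.lean`
(p98045: crux → equilibrium rung, unconditional), `Negative/Kinematics.lean` (p99658: functional,
impulse = normal relative velocity ≤ relative speed, grazing = 0), `Negative/ShapeSeparation.lean`
(p106653, cycle 2, in review: crux shape = UI shape ∧ crux-shaped fraction statement; the crux is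
crux-shaped), `Negative/ShapeWitnesses.lean` (cycle 2, to follow: spike / geometric separating laws).

## The statement, read back (`collisionActivityTails_iff`, definitional)

For all continuous profiles `a₀ > 0`, `θ₀ > 0`, `u₀` there is `σ₀ > 0` such that for all
`0 < σ < σ₀`, every horizon `T`, every classical hs-Euler solution `(ρ,u,θ)` on `[0,T)`, every
family of hard-sphere flows `Φ N` (`N+1` spheres of diameter `σ(N+1)^{-1/3}` on `𝕋³`): IF the local
Gibbs laws `λ_N = localGibbsLaw σ a₀ u₀ θ₀ N (Φ N)` satisfy the hydrodynamic LLN at `t = 0`, THEN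
for every `t ∈ [0,T)`: `∃ V₀ > 0 ∀ V ≥ V₀ ∀ ε > 0 ∃ τ₀ > 0 ∀ τ ≥ τ₀ ∃ N₀ ∀ N ≥ N₀ ∀ s ∈ [0,t]`,
`E_{λ_N}[(N+1)⁻¹ Σᵢ 𝟙{aᵢ > V} aᵢ] ≤ ε`, where `aᵢ = (σ/τ) Σ_{collisions of i, times in (s, s+w]}
|vᵢ⁺ − vᵢ⁻|` along the orbit of the initial datum (`activity`), `w = τ(N+1)^{-1/3}` (`window`);
the integrand is this file's `activityTail N V (activity …)`.

Coercion / junk audit (all benign): `∫⁻ ∘ ENNReal.ofReal` of a nonnegative real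
(`activity_nonneg`, `activityTail_nonneg`); `λ_N ≪` Liouville and is a probability measure for
`σ ≤ 1/2` (`isProbabilityMeasure_localGibbsLaw`), the ZERO measure when spheres cannot fit (then
trivially true); the flow is junk only off a conull invariant good set; `collisionSum` is a `finsum`
over the ORBIT's collision times (derived from `Φ.flow`, not a free field; junk `0` for infinitely
many collision times, a null event); ordered contact pairs, `c.fst = i` selects exactly one record
per collision of `i`; `T ≤ 0` vacuous; `N₀` after `τ`, `s`-uniformity after `N₀` — the intended
order.  The Gibbs mean of `aᵢ` is `6θ₀(Z−1)` (virial theorem, both partners), not the route text's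
`3θ₀(Z−1)`: immaterial here (`V₀` existential).

## Findings (cycle 2, §7) — still NO KILL; split audit, new regimes
7. The lead's cycle-2 split of the open stubs into a UI half and a FRACTION-LLN half is an
   EQUIVALENCE — in the abstract (`cruxShape_iff_uiShape_and_fracShape`, §7a: spike family fraction ✓
   UI ✗, geometric law UI ✓ fraction ✗, both halves load-bearing) and against the PUBLISHED bodies
   (§7g: `CrowdedCollisionTails → CrowdedFractionLLN`, `→ CrowdedActivityUI` given the measurability
   conjunct; the published `CrowdedActivityUI` IS in UI shape, so the all-windows caveat of §7b does
   not bite; no stub misstated).  For `F²` the UI half is traded for the external open item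
   `KineticEnergyTails` (13087) + landed packing statics.  New typed refutation targets: the weaker
   rungs `CollisionActivityFraction` / `EquilibriumActivityFraction` (§7f, landed as
   `Negative/FractionRung.lean` p107672) and the equilibrium rungs of the fraction stubs (§7g).  The
   lead's question ("`CrowdedFractionLLN` false while the crux holds?"): cold visitor HUBS are not
   excluded by the crux (budget `Σ Fcr ≤ 343 Σ a` allows a fraction `f` at level `V ≤ 343m/f`),
   translating platoons are (members hyperactive); no dynamical witness for hubs — same kind of
   co-moving window LLN as the crux; verdict: not false for any identifiable reason.
8. New regimes (§7c): global-in-time shock-free Euler data (steady shear flows make `T = ∞`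
   admissible — the crux then claims tails at every fixed `t`; consistent because `N → ∞` at fixed
   `t`), the fast-particle route `aᵢ ≍ cπσ³u²` (needs sustained speed against equal-mass
   thermalisation), initial layer (none), order of limits, and an independent junk re-audit of the
   summand (`contactPairs` = all touching ordered pairs at a collision time — harmless, the impulse
   is read off the configuration; every junk convention only LOWERS the tail).  No kill; verdict
   unchanged (open, physically true, formally tight).

## Findings (cycle 1) — NO KILL, no misstatement; the statement elaborates (rc 0)

1. JUNK-MODEL / DEGENERATE attacks fail (§4b): no freedom in `Φ`; large `σ`, `T ≤ 0`, small `N`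
   are vacuous-true, never false; the Euler data and the LLN hypothesis are decoration except for
   the horizon `T` (pure a priori estimate on `(profiles, σ, Φ, t)`).
2. SHAPE (§3, checked): because `V` is fixed BEFORE `ε`, the crux is NOT uniform integrability but
   ASYMPTOTIC ESSENTIAL BOUNDEDNESS of the long-window activity: `CruxShape` ⇒ `UIShape`
   (`CruxShape.uiShape`) and strictly so — a bounded MEAN activity does not even give UI
   (`exists_meanBounded_not_uiShape`, spike laws: a fraction `(N+1)⁻¹` of caged particles carrying
   all the activity), and UI together with uniform bounds on ALL moments does not give the crux
   shape (`exists_uiShape_moments_not_cruxShape`, the geometric law).  The crux is literally of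
   this shape (`collisionActivityTails_iff_cruxShape`).  CONSEQUENCE FOR PROVERS: no estimate
   `sup E[aᵢ^p] ≤ C_p` — no virial/pressure bound, no extensive Serre-type impulse bound, no
   entropy bound — can prove it; the proof must be a CONCENTRATION statement (LLN in the window
   length `τ`) for the tagged activity under the true law.  CONSEQUENCE FOR PLANNERS: the dock
   (ClampedWindowDock (vi): `V`, `β ≤ β₀(V)` frozen through the Gronwall factor `e^{t/β}`) really
   consumes this strong shape; the UI shape would NOT suffice, so no weakening is proposed.
3. KINEMATICS (§2, checked): the summand is `|⟨vᵢ − vⱼ, n⟩|/|n| ≤ |vᵢ − vⱼ| ≤ |vᵢ| + |vⱼ|`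
   (`impulse_ofConfig_eq/_le/_le_add`) and vanishes for grazing collisions: high activity at
   bounded speeds needs MANY collisions (crux ⇐ collision-NUMBER tails ∧ velocity tails), while
   activity tails say nothing about collision counts (no converse).
4. LOAD-BEARING (§4, typed, paper verdicts): the threshold `V₀ > 0` (no-threshold variant =
   mean activity → 0, false by the virial theorem) and the long-window limit `τ → ∞` (all-windows
   variant false: sub-mean-free-time windows put the whole mean above any `V`); both variants are
   STRENGTHENINGS of the crux (`collisionActivityTails_of_noThreshold/_of_allWindows`), so their
   falsity does not touch it.  Neither is closable in Lean now: each needs a quantitative LOWER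
   bound on the collision frequency of a tagged sphere under the flow from Gibbs data (the tree's
   flow API is qualitative).  The `L¹` currency is forced (the stmt-14441 blob kills every
   exponential-in-`N` concentration of the tail, §4b).
5. EQUILIBRIUM REDUCTION (§5, checked, UNCONDITIONAL): `CollisionActivityTails →
   EquilibriumCollisionActivityTails` (`equilibriumCollisionActivityTails_of_crux'`; constant states
   are Euler solutions, and the constant-profile LLN has a CONSTANT density —
   `constantProfileLLN_holds`, by porting the `rhoLim` identification of the DenseExcursion
   disproof); so any equilibrium counterexample kills the crux
   (`not_collisionActivityTails_of_not_equilibrium`).  WHY IT RESISTS (substance): a counterexample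
   must make the TRUE pre-shock law cage a non-vanishing activity-weighted fraction of spheres over
   `τ′ = τπσ²√θ₀ → ∞` mean free times, or at equilibrium exhibit persistent caging of a tagged
   sphere with non-vanishing weighted probability — against the droplet-evaporation heuristic
   `P ≲ exp(-c(τ/σ)³)`.  No rigorous tool controls `N`-body hard-sphere dynamics at fixed
   density beyond Lanford's time in either direction (upper bounds on collision numbers:
   Burago–Ferleger–Kononenko 1998 for finitely many balls in free space, Vaserstein 1979 /
   Illner 1989–90; growth-in-`N` a priori impulse bounds: Serre 2021/2024; exponentially many
   collisions of few balls ARE kinematically possible: Burago–Ivanov 2018 — so no cheap pathwise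
   obstruction either).  Verdict: open, physically true (local equilibrium), not refutable with
   present tools; its negation would sink the local-equilibrium picture itself.
6. SEARCHES: `lit search` / galaxy: search-degraded this session (searchd rc 75); `ledger
   negatives`: gate socket unavailable at session start (retried); barrier catalogue read by name:
   `HighMomentumCutoff(Narrow)` is the only kinetic-tail entry (cubic velocity tails — the
   companion crux 9235, not this functional); no collision-count barrier is catalogued
   (candidate noted in NOTES, not filed: nothing proved).

## Index
* §1 `impulseOf`, `activity`, `tailFn`, `activityTail`, `window`, `collisionActivityTails_iff`;
  §1b basic API (`activity_nonneg`, `activityTail_le_mean`, `activityTail_zero`,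
  `activityTail_anti`, `activityTail_eq_zero_iff`).
* §2 `norm_reflectVel_fst_sub` (= normal component), `_le` (≤ relative speed), `_eq_zero_of_grazing`,
  `impulse_ofConfig_eq/_le/_le_add`.
* §3 `CruxShape`, `UIShape`, `CruxShape.uiShape`; §3a `spikeLaw`, `exists_meanBounded_not_uiShape`;
  §3b `geomLaw`, `uiShape_geomLaw`, `not_cruxShape_geomLaw`, `exists_uiShape_moments_not_cruxShape`;
  §3c `collisionActivityTails_iff_cruxShape`.
* §4 `CollisionActivityTailsNoThreshold`, `CollisionActivityTailsAllWindows` (+ `_of_` lemmas);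
  §4b non-load-bearing hypotheses (prose).
* §5 `EquilibriumCollisionActivityTails` (typed rung); §5b `isHardSphereEulerSolution_const`,
  `ConstantProfileLLN`, `equilibriumCollisionActivityTails_of_crux`; §5c (port) `eq_of_tendsto_measure_lt`,
  `eq_of_forall_integral_mul_eq`, `densityLLN_rhoLim`, `rhoLim_const`, `constantProfileLLN_holds`,
  `equilibriumCollisionActivityTails_of_crux'`, `not_collisionActivityTails_of_not_equilibrium`.
* §6 Targets — line SketchK1: joint sufficiency formal; stub audit of `NearFieldKineticTails`,
  `CrowdedCollisionTails` (no kill, crux-kind); §6b `TailStatement` / `EquilibriumTailStatement`,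
  `equilibriumTailStatement_of_tailStatement` (every crux-shaped tail statement implies its
  equilibrium rung), instances `equilibrium_of_nearFieldKineticTails`, `equilibrium_of_crowdedCollisionTails`,
  `collisionActivityTails_iff_tailStatement` (the crux is the instance `F = activity`).
* §7 (cycle 2) §7a `lawFrac`, `ofReal_mul_lawFrac_le` (Chebyshev at the threshold), `lawTail_le_add`
  (truncation), `CruxShape.fracShape`, `cruxShape_of_uiShape_of_fracShape`,
  `cruxShape_iff_uiShape_and_fracShape`, `fracShape_spikeLaw`, `not_fracShape_geomLaw`;
  §7b line audit after the 12:20Z reshape (fraction stubs crux-kind; UI stub: shape caveat;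
  `KineticEnergyTails` external; the lead's separation question answered); §7c new regimes (shear
  data `T = ∞`, fast particles, initial layer, junk re-audit) — no kill; §7d
  `IsGlobalHardSphereEulerSolution`, `collisionActivityTails_allTimes` (global data ⇒ tails at every
  `t ≥ 0`), rate remark (EDMD tails decay like `e^{-cτ}`, CLT regime, not `e^{-c(τ/σ)³}`);
  §7e literature status; §7f weaker RUNGS `CollisionActivityFraction`, `CollisionActivityUI`,
  `EquilibriumActivityFraction` with `…_of_crux` (Chebyshev at the threshold) and
  `not_collisionActivityTails_of_not_equilibriumActivityFraction`; §7g audit of the PUBLISHED cycle-2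
  stub bodies (13:51Z): `FracStatement` / `UIStatement` / `UIStatementMeas` / `MeasStatement`,
  `fracStatement_of_tailStatement`, `uiStatement(Meas)_of_tailStatement`, instances
  `crowdedFractionLLN_of_crowdedCollisionTails`, `crowdedActivityUI_of_crowdedCollisionTails`,
  `nearFieldFractionLLN_of_nearFieldKineticTails`, `EquilibriumFracStatement` +
  `equilibriumFracStatement_of_fracStatement`, `not_crowdedFractionLLN_of_not_equilibrium`; the lead's
  hub/platoon question answered (budget arithmetic: hubs not crux-excluded; platoons are; no witness);
  §7h `exists_budget_cruxTails_not_fracShape` (abstract hub law: crux tails for `a` + mean budget for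
  `Fcr` + failure of the `Fcr` fraction statement).
-/

noncomputable section

open MeasureTheory Filter Set Topology
open scoped ENNReal

namespace Summit.AtomisticToContinuum.HydrodynamicLimit.Cruxes.CollisionActivityTails.Disproof

open Literature.MathematicalPhysics.KineticTheory Literature.Analysis.FluidPDE

/-! ## §1 The crux functional -/

/-- A hard-sphere flow of `N + 1` spheres of reduced diameter `σ` on `𝕋³` (the crux's `Φ N`). -/
abbrev Flow (σ : ℝ) (N : ℕ) : Type :=
  HardSphereFlow (Torus.geometry (Fin 3)) (hsDiameter σ N) (N + 1)

/-- Phase space of `N + 1` spheres. -/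
abbrev Cfg (N : ℕ) : Type := Config (N + 1) (Fin 3) T3

/-- Collision records of `N + 1` spheres. -/
abbrev Rec (N : ℕ) : Type := HardSphereCollisionRecord (Fin 3) T3 (N + 1)

/-- The impulse received by particle `i` in the (ordered) record `c`: `|v_i⁺ - v_i⁻|` if `i` is
the first particle of the ordered pair, `0` otherwise (each binary collision of `i` appears exactly
once with `c.fst = i`). This is the crux's summand. -/
def impulseOf {N : ℕ} (i : Fin (N + 1)) (c : Rec N) : ℝ :=
  if c.fst = i then ‖c.postVel.1 - c.preVel.1‖ else 0

/-- The window activity of particle `i`: `a_i = (σ/τ) Σ_{collisions of i with times in S} |Δv_i|`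
(the crux takes `S = (s, s + w]`, `w = τ (N+1)^{-1/3}`). -/
def activity {σ : ℝ} {N : ℕ} (Φ : Flow σ N) (τ : ℝ) (S : Set ℝ) (i : Fin (N + 1)) (z : Cfg N) : ℝ :=
  σ / τ * Φ.collisionSum S (impulseOf i) z

/-- The scalar tail functional `y ↦ 𝟙{V < y} y`. -/
def tailFn (V y : ℝ) : ℝ := Set.indicator {y : ℝ | V < y} (fun y => y) y

/-- The crux's empirical activity tail `(N+1)⁻¹ Σ_i 𝟙{V < a_i} a_i` of an activity vector. -/
def activityTail (N : ℕ) (V : ℝ) (a : Fin (N + 1) → ℝ) : ℝ :=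
  ((N : ℝ) + 1)⁻¹ * ∑ i : Fin (N + 1), tailFn V (a i)

/-- The crux's window `w_N = τ (N+1)^{-1/3}`. -/
def window (τ : ℝ) (N : ℕ) : ℝ := τ * ((N : ℝ) + 1) ^ (-(1 / 3 : ℝ))

/-- **Read-back.** `CollisionActivityTails` restated through `activity` / `activityTail` / `window`
(definitional unfolding only: the `let`s of the route decl are these definitions). -/
theorem collisionActivityTails_iff :
    Summit.AtomisticToContinuum.HydrodynamicLimit.Theses.TwoClocks.CollisionActivityTails ↔
    ∀ (a₀ θ₀ : T3 → ℝ) (u₀ : T3 → V3), Continuous a₀ → Continuous θ₀ → Continuous u₀ →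
      (∀ x, 0 < a₀ x) → (∀ x, 0 < θ₀ x) → ∃ σ₀ : ℝ, 0 < σ₀ ∧ ∀ σ : ℝ, 0 < σ → σ < σ₀ →
      ∀ (T : ℝ) (ρ θ : ℝ → T3 → ℝ) (u : ℝ → T3 → V3), IsHardSphereEulerSolution σ T ρ u θ →
      ∀ Φ : (N : ℕ) → Flow σ N,
      TendstoHydroFieldsAt (fun N => localGibbsLaw σ a₀ u₀ θ₀ N (Φ N)) Φ ρ u θ 0 →
      ∀ t ∈ Set.Ico 0 T, ∃ V₀ : ℝ, 0 < V₀ ∧ ∀ V : ℝ, V₀ ≤ V → ∀ ε : ℝ, 0 < ε →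
      ∃ τ₀ : ℝ, 0 < τ₀ ∧ ∀ τ : ℝ, τ₀ ≤ τ → ∃ N₀ : ℕ, ∀ N : ℕ, N₀ ≤ N → ∀ s ∈ Set.Icc 0 t,
        ∫⁻ z, ENNReal.ofReal (activityTail N V
            (fun i => activity (Φ N) τ (Set.Ioc s (s + window τ N)) i z))
          ∂(localGibbsLaw σ a₀ u₀ θ₀ N (Φ N)) ≤ ENNReal.ofReal ε :=
  Iff.rfl


/-! ### §1b Basic properties of the functional -/

/-- Above the threshold the tail functional is the identity. -/
theorem tailFn_of_lt {V y : ℝ} (h : V < y) : tailFn V y = y :=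
  Set.indicator_of_mem (show y ∈ {y : ℝ | V < y} from h) _

/-- At or below the threshold the tail functional vanishes. -/
theorem tailFn_of_le {V y : ℝ} (h : y ≤ V) : tailFn V y = 0 :=
  Set.indicator_of_notMem (show y ∉ {y : ℝ | V < y} from fun h' => (not_lt.2 h) h') _

/-- The tail functional of a nonnegative argument is nonnegative. -/
theorem tailFn_nonneg {V y : ℝ} (hy : 0 ≤ y) : 0 ≤ tailFn V y :=
  Set.indicator_apply_nonneg fun _ => hy

/-- For a nonnegative threshold the tail functional is nonnegative everywhere. -/
theorem tailFn_nonneg_of_threshold {V : ℝ} (hV : 0 ≤ V) (y : ℝ) : 0 ≤ tailFn V y :=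
  Set.indicator_nonneg (fun _ (h : V < _) => hV.trans h.le) _

/-- The tail functional is dominated by the (nonnegative) argument. -/
theorem tailFn_le_self {V y : ℝ} (hy : 0 ≤ y) : tailFn V y ≤ y :=
  Set.indicator_apply_le' (fun _ => le_rfl) (fun _ => hy)

/-- The tail is antitone in the threshold (on nonnegative arguments). -/
theorem tailFn_anti {V V' y : ℝ} (hVV' : V ≤ V') (hy : 0 ≤ y) : tailFn V' y ≤ tailFn V y := by
  by_cases h : V' < y
  · rw [tailFn_of_lt h, tailFn_of_lt (hVV'.trans_lt h)]
  · rw [tailFn_of_le (not_lt.1 h)]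
    exact tailFn_nonneg hy

/-- With threshold `0` the "tail" is the whole (nonnegative) quantity. -/
theorem tailFn_zero {y : ℝ} (hy : 0 ≤ y) : tailFn 0 y = y := by
  rcases hy.lt_or_eq with h | h
  · exact tailFn_of_lt h
  · rw [← h, tailFn_of_le le_rfl]

/-- The tail functional is measurable. -/
theorem measurable_tailFn (V : ℝ) : Measurable (tailFn V) :=
  measurable_id.indicator (measurableSet_lt measurable_const measurable_id)

/-- The impulse summand is nonnegative. -/
theorem impulseOf_nonneg {N : ℕ} (i : Fin (N + 1)) (c : Rec N) : 0 ≤ impulseOf i c := by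
  unfold impulseOf
  split_ifs
  · exact norm_nonneg _
  · exact le_rfl

/-- A collision sum of a nonnegative functional is nonnegative (a `finsum` of finite sums of
nonnegative terms; also in the junk case of infinitely many collision times, where it is `0`). -/
theorem collisionSum_nonneg {σ : ℝ} {N : ℕ} (Φ : Flow σ N) (S : Set ℝ) {F : Rec N → ℝ}
    (hF : ∀ c, 0 ≤ F c) (z : Cfg N) : 0 ≤ Φ.collisionSum S F z := by
  unfold HardSphereFlow.collisionSum Literature.Analysis.FluidPDE.collisionSum
    Literature.Analysis.FluidPDE.collisionPairSum
  exact finsum_nonneg fun t => finsum_nonneg fun _ => Finset.sum_nonneg fun p _ => hF _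

/-- The window activity is nonnegative (for `σ, τ ≥ 0`). -/
theorem activity_nonneg {σ : ℝ} {N : ℕ} (hσ : 0 ≤ σ) {τ : ℝ} (hτ : 0 ≤ τ) (Φ : Flow σ N)
    (S : Set ℝ) (i : Fin (N + 1)) (z : Cfg N) : 0 ≤ activity Φ τ S i z :=
  mul_nonneg (div_nonneg hσ hτ) (collisionSum_nonneg Φ S (impulseOf_nonneg i) z)

/-- The activity tail of a nonnegative activity vector is nonnegative. -/
theorem activityTail_nonneg {N : ℕ} {V : ℝ} {a : Fin (N + 1) → ℝ} (ha : ∀ i, 0 ≤ a i) :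
    0 ≤ activityTail N V a :=
  mul_nonneg (by positivity) (Finset.sum_nonneg fun i _ => tailFn_nonneg (ha i))

/-- The activity tail is at most the mean activity `(N+1)⁻¹ Σ_i a_i`. -/
theorem activityTail_le_mean {N : ℕ} (V : ℝ) {a : Fin (N + 1) → ℝ} (ha : ∀ i, 0 ≤ a i) :
    activityTail N V a ≤ ((N : ℝ) + 1)⁻¹ * ∑ i : Fin (N + 1), a i :=
  mul_le_mul_of_nonneg_left (Finset.sum_le_sum fun i _ => tailFn_le_self (ha i)) (by positivity)

/-- With threshold `0` the activity tail IS the mean activity. -/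
theorem activityTail_zero {N : ℕ} {a : Fin (N + 1) → ℝ} (ha : ∀ i, 0 ≤ a i) :
    activityTail N 0 a = ((N : ℝ) + 1)⁻¹ * ∑ i : Fin (N + 1), a i := by
  unfold activityTail
  congr 1
  exact Finset.sum_congr rfl fun i _ => tailFn_zero (ha i)

/-- The activity tail is antitone in the threshold. -/
theorem activityTail_anti {N : ℕ} {V V' : ℝ} (hVV' : V ≤ V') {a : Fin (N + 1) → ℝ}
    (ha : ∀ i, 0 ≤ a i) : activityTail N V' a ≤ activityTail N V a :=
  mul_le_mul_of_nonneg_left (Finset.sum_le_sum fun i _ => tailFn_anti hVV' (ha i)) (by positivity)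

/-- The activity tail vanishes iff every activity is at most the threshold (for `V ≥ 0`). -/
theorem activityTail_eq_zero_iff {N : ℕ} {V : ℝ} (hV : 0 ≤ V) (a : Fin (N + 1) → ℝ) :
    activityTail N V a = 0 ↔ ∀ i, a i ≤ V := by
  unfold activityTail
  have hpos : (0 : ℝ) < ((N : ℝ) + 1)⁻¹ := by positivity
  rw [mul_eq_zero, or_iff_right hpos.ne']
  rw [Finset.sum_eq_zero_iff_of_nonneg fun i _ => tailFn_nonneg_of_threshold hV (a i)]
  simp only [Finset.mem_univ, forall_const]
  refine forall_congr' fun i => ⟨fun h => ?_, fun h => tailFn_of_le h⟩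
  by_contra hlt
  rw [not_le] at hlt
  rw [tailFn_of_lt hlt] at h
  exact (hV.trans_lt hlt).ne' h

/-! ## §2 Kinematics of one collision: impulse = |normal relative velocity| ≤ relative speed

The crux's summand `|v_i⁺ - v_i⁻|` is, for a record read off a configuration
(`HardSphereCollisionRecord.ofConfig`, the only records a `collisionSum` ever sees), the normal
component `|⟨v_i - v_j, n⟩|/|n|` of the relative velocity along the impact vector `n = x_i - x_j`:
it is bounded by the relative speed (so high activity at bounded speeds needs MANY collisions:
the crux is implied by a collision-NUMBER tail bound plus velocity tails), and it VANISHES for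
grazing collisions (so the converse reduction fails: activity tails say nothing about collision
counts). -/

section Kinematics

variable {E : Type*} [NormedAddCommGroup E] [InnerProductSpace ℝ E]

/-- The velocity jump of the first partner under the reflection law. -/
theorem reflectVel_fst_sub (n : E) (p : E × E) :
    (reflectVel n p).1 - p.1 = -((inner ℝ (p.1 - p.2) n / ‖n‖ ^ 2) • n) := by
  simp only [reflectVel]
  abel

/-- The velocity jump of the second partner under the reflection law. -/
theorem reflectVel_snd_sub (n : E) (p : E × E) :
    (reflectVel n p).2 - p.2 = (inner ℝ (p.1 - p.2) n / ‖n‖ ^ 2) • n := by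
  simp only [reflectVel]
  abel

/-- The velocity jump of the first partner is the normal component of the relative velocity. -/
theorem norm_reflectVel_fst_sub (n : E) (p : E × E) :
    ‖(reflectVel n p).1 - p.1‖ = |inner ℝ (p.1 - p.2) n| / ‖n‖ := by
  rw [reflectVel_fst_sub, norm_neg, norm_smul, Real.norm_eq_abs, abs_div,
    abs_of_nonneg (sq_nonneg ‖n‖)]
  by_cases hn : n = 0
  · simp [hn]
  · have hn' : ‖n‖ ≠ 0 := norm_ne_zero_iff.2 hn
    field_simp

/-- Both partners receive the same impulse. -/
theorem norm_reflectVel_snd_sub (n : E) (p : E × E) :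
    ‖(reflectVel n p).2 - p.2‖ = ‖(reflectVel n p).1 - p.1‖ := by
  rw [reflectVel_snd_sub, reflectVel_fst_sub, norm_neg]

/-- **Impulse ≤ relative speed** (Cauchy–Schwarz). -/
theorem norm_reflectVel_fst_sub_le (n : E) (p : E × E) :
    ‖(reflectVel n p).1 - p.1‖ ≤ ‖p.1 - p.2‖ := by
  rw [norm_reflectVel_fst_sub]
  by_cases hn : n = 0
  · simp [hn]
  · rw [div_le_iff₀ (norm_pos_iff.2 hn)]
    exact abs_real_inner_le_norm _ _

/-- **Grazing collisions transfer nothing**: if the relative velocity is orthogonal to the impact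
vector, the impulse vanishes (no lower bound per collision). -/
theorem norm_reflectVel_fst_sub_eq_zero_of_grazing {n : E} {p : E × E}
    (h : inner ℝ (p.1 - p.2) n = 0) : ‖(reflectVel n p).1 - p.1‖ = 0 := by
  rw [norm_reflectVel_fst_sub, h, abs_zero, zero_div]

end Kinematics

/-- For a record read off a configuration, the crux's summand `|v_fst⁺ - v_fst⁻|` is at most the
relative speed of the pair, hence at most `|v_i| + |v_j|`. -/
theorem impulse_ofConfig_le {d : Type*} [Fintype d] {X : Type*} {n : ℕ} (G : Geometry d X)
    (ε : ℝ) (z : Config n d X) (t : ℝ) (i j : Fin n) :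
    ‖(HardSphereCollisionRecord.ofConfig G ε z t i j).postVel.1 -
        (HardSphereCollisionRecord.ofConfig G ε z t i j).preVel.1‖ ≤ ‖(z i).2 - (z j).2‖ := by
  simp only [HardSphereCollisionRecord.ofConfig_postVel, HardSphereCollisionRecord.ofConfig_preVel]
  rw [← norm_neg, neg_sub]
  exact norm_reflectVel_fst_sub_le _ _

/-- The crux's summand is at most the sum of the two speeds. -/
theorem impulse_ofConfig_le_add {d : Type*} [Fintype d] {X : Type*} {n : ℕ} (G : Geometry d X)
    (ε : ℝ) (z : Config n d X) (t : ℝ) (i j : Fin n) :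
    ‖(HardSphereCollisionRecord.ofConfig G ε z t i j).postVel.1 -
        (HardSphereCollisionRecord.ofConfig G ε z t i j).preVel.1‖ ≤ ‖(z i).2‖ + ‖(z j).2‖ :=
  (impulse_ofConfig_le G ε z t i j).trans (norm_sub_le _ _)

/-- The crux's summand for a record read off a configuration, in closed form: the normal
component of the relative velocity along the separation vector. -/
theorem impulse_ofConfig_eq {d : Type*} [Fintype d] {X : Type*} {n : ℕ} (G : Geometry d X)
    (ε : ℝ) (z : Config n d X) (t : ℝ) (i j : Fin n) :
    ‖(HardSphereCollisionRecord.ofConfig G ε z t i j).postVel.1 -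
        (HardSphereCollisionRecord.ofConfig G ε z t i j).preVel.1‖ =
      |inner ℝ ((z i).2 - (z j).2) (G.sepVec (z i).1 (z j).1)| / ‖G.sepVec (z i).1 (z j).1‖ := by
  simp only [HardSphereCollisionRecord.ofConfig_postVel, HardSphereCollisionRecord.ofConfig_preVel]
  rw [← norm_neg, neg_sub]
  exact norm_reflectVel_fst_sub _ _



/-! ## §3 The SHAPE of the claim: asymptotic essential boundedness, not uniform integrability

Since `V` is quantified BEFORE `ε`, the crux asserts, for every fixed `V ≥ V₀`,
`lim_{τ→∞} limsup_{N→∞} sup_{s≤t} E[(N+1)⁻¹ Σᵢ aᵢ 𝟙{aᵢ > V}] = 0`: asymptotically the per-particle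
window activity carries NO mass above the deterministic level `V₀` (in activity-weighted mean).
This is strictly stronger than uniform integrability (`∀ ε ∃ V`), and no family of moment bounds
implies it.  Everything the functional sees of the laws is the mixture law on `ℝ` of the activity
of a uniformly chosen particle, so we argue over abstract families of laws `ν τ N` on `ℝ`. -/

/-- The quantifier shape of the crux over an abstract tail functional `E V τ N`
(in the crux: `E V τ N = sup_{s ≤ t} E_{λ_N}[activityTail N V (a(s))]`, all other data frozen). -/
def CruxShape (E : ℝ → ℝ → ℕ → ℝ≥0∞) : Prop :=
  ∃ V₀ : ℝ, 0 < V₀ ∧ ∀ V : ℝ, V₀ ≤ V → ∀ ε : ℝ, 0 < ε → ∃ τ₀ : ℝ, 0 < τ₀ ∧ ∀ τ : ℝ, τ₀ ≤ τ →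
    ∃ N₀ : ℕ, ∀ N : ℕ, N₀ ≤ N → E V τ N ≤ ENNReal.ofReal ε

/-- The uniform-integrability shape: the threshold may depend on the accuracy. -/
def UIShape (E : ℝ → ℝ → ℕ → ℝ≥0∞) : Prop :=
  ∀ ε : ℝ, 0 < ε → ∃ V : ℝ, ∃ τ₀ : ℝ, 0 < τ₀ ∧ ∀ τ : ℝ, τ₀ ≤ τ →
    ∃ N₀ : ℕ, ∀ N : ℕ, N₀ ≤ N → E V τ N ≤ ENNReal.ofReal ε

/-- The crux shape implies the UI shape (take `V = V₀`). -/
theorem CruxShape.uiShape {E : ℝ → ℝ → ℕ → ℝ≥0∞} (h : CruxShape E) : UIShape E := by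
  obtain ⟨V₀, -, h⟩ := h
  exact fun ε hε => ⟨V₀, h V₀ le_rfl ε hε⟩

/-- The tail functional `E_μ[𝟙{V < y} y]` of a law `μ` on `ℝ`. -/
def lawTail (μ : Measure ℝ) (V : ℝ) : ℝ≥0∞ := ∫⁻ y, ENNReal.ofReal (tailFn V y) ∂μ

/-- The mean `E_μ[y⁺]` of a law on `ℝ`. -/
def lawMean (μ : Measure ℝ) : ℝ≥0∞ := ∫⁻ y, ENNReal.ofReal y ∂μ

/-! ### §3a A bounded MEAN activity (virial / pressure information) does not even give UI -/

/-- The spike family: activity `0` with probability `1 - (N+1)⁻¹`, activity `N + 1` with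
probability `(N+1)⁻¹` (a vanishing fraction of caged particles carrying all the activity). -/
def spikeLaw (N : ℕ) : Measure ℝ :=
  ENNReal.ofReal (1 - ((N : ℝ) + 1)⁻¹) • Measure.dirac (0 : ℝ) +
    ENNReal.ofReal (((N : ℝ) + 1)⁻¹) • Measure.dirac ((N : ℝ) + 1)

/-- `(N+1)⁻¹ ≤ 1`. -/
theorem succ_inv_le_one (N : ℕ) : ((N : ℝ) + 1)⁻¹ ≤ 1 :=
  inv_le_one_of_one_le₀ (by simp)

/-- The spike laws are probability measures. -/
instance isProbabilityMeasure_spikeLaw (N : ℕ) : IsProbabilityMeasure (spikeLaw N) := by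
  refine ⟨?_⟩
  simp only [spikeLaw, Measure.coe_add, Measure.coe_smul, Pi.add_apply, Pi.smul_apply,
    measure_univ, smul_eq_mul, mul_one]
  rw [← ENNReal.ofReal_add (by linarith [succ_inv_le_one N]) (by positivity)]
  simp

/-- Integration against a spike law. -/
theorem lintegral_spikeLaw (N : ℕ) (f : ℝ → ℝ≥0∞) :
    ∫⁻ y, f y ∂(spikeLaw N) =
      ENNReal.ofReal (1 - ((N : ℝ) + 1)⁻¹) * f 0 + ENNReal.ofReal (((N : ℝ) + 1)⁻¹) * f ((N : ℝ) + 1) := by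
  simp only [spikeLaw, lintegral_add_measure, lintegral_smul_measure, lintegral_dirac, smul_eq_mul]

/-- The spike family has mean activity exactly `1`. -/
theorem lawMean_spikeLaw (N : ℕ) : lawMean (spikeLaw N) = 1 := by
  rw [lawMean, lintegral_spikeLaw, ENNReal.ofReal_zero, mul_zero, zero_add,
    ← ENNReal.ofReal_mul (by positivity), inv_mul_cancel₀ (by positivity), ENNReal.ofReal_one]

/-- At the origin the tail functional vanishes whatever the threshold. -/
theorem tailFn_at_zero (V : ℝ) : tailFn V 0 = 0 := by
  by_cases h : V < 0
  · exact tailFn_of_lt h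
  · exact tailFn_of_le (not_lt.1 h)

/-- ... and tail `1` above every threshold `V < N + 1`. -/
theorem lawTail_spikeLaw {N : ℕ} {V : ℝ} (hVN : V < (N : ℝ) + 1) :
    lawTail (spikeLaw N) V = 1 := by
  rw [lawTail, lintegral_spikeLaw, tailFn_at_zero, ENNReal.ofReal_zero, mul_zero, zero_add,
    tailFn_of_lt hVN, ← ENNReal.ofReal_mul (by positivity), inv_mul_cancel₀ (by positivity),
    ENNReal.ofReal_one]

/-- **A uniform bound on the mean activity implies nothing**: the spike family has mean `1` and
fails even the UI shape (hence the crux shape).  Moral: pressure / virial / extensive-impulse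
information (`E Σᵢ aᵢ ≤ C (N+1)`, all that a Serre-type estimate could give even if it were
extensive) is blind to the crux. -/
theorem exists_meanBounded_not_uiShape :
    ∃ ν : ℝ → ℕ → Measure ℝ, (∀ τ N, IsProbabilityMeasure (ν τ N)) ∧
      (∀ τ N, lawMean (ν τ N) ≤ 1) ∧ ¬ UIShape (fun V τ N => lawTail (ν τ N) V) := by
  refine ⟨fun _ N => spikeLaw N, fun _ N => isProbabilityMeasure_spikeLaw N,
    fun _ N => (lawMean_spikeLaw N).le, fun h => ?_⟩
  obtain ⟨V, τ₀, hτ₀, h⟩ := h (1 / 2) (by norm_num)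
  obtain ⟨N₀, hN⟩ := h τ₀ le_rfl
  -- a large `N` beyond `N₀` and beyond the threshold
  set N : ℕ := max N₀ ⌈max V 0⌉₊
  have hN₀ : N₀ ≤ N := le_max_left _ _
  have hVN : max V 0 < (N : ℝ) + 1 := by
    have h1 : max V 0 ≤ (⌈max V 0⌉₊ : ℝ) := Nat.le_ceil _
    have h2 : (⌈max V 0⌉₊ : ℝ) ≤ (N : ℝ) := by exact_mod_cast le_max_right N₀ _
    linarith
  have key := hN N hN₀
  simp only at key
  rw [lawTail_spikeLaw ((le_max_left V 0).trans_lt hVN)] at key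
  have : (1 : ℝ≥0∞) ≤ ENNReal.ofReal (1 / 2) := key
  rw [← ENNReal.ofReal_one] at this
  have := (ENNReal.ofReal_le_ofReal_iff (by norm_num)).1 this
  norm_num at this

/-! ### §3b UI and ALL moment bounds do not give the crux shape -/

/-- Geometric weights `2^{-(k+1)}`, `k ∈ ℕ` (total mass `1`). -/
def geomWeight (k : ℕ) : ℝ := (1 / 2 : ℝ) ^ (k + 1)

/-- The geometric weights are positive. -/
theorem geomWeight_pos (k : ℕ) : 0 < geomWeight k := by unfold geomWeight; positivity

/-- The geometric activity law `Σ_k 2^{-(k+1)} δ_{k+1}`: a FIXED integrable law with unbounded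
support (every moment finite). -/
def geomLaw : Measure ℝ :=
  Measure.sum fun k : ℕ => ENNReal.ofReal (geomWeight k) • Measure.dirac ((k : ℝ) + 1)

/-- Integration against the geometric law is the weighted series. -/
theorem lintegral_geomLaw (f : ℝ → ℝ≥0∞) :
    ∫⁻ y, f y ∂geomLaw = ∑' k : ℕ, ENNReal.ofReal (geomWeight k) * f ((k : ℝ) + 1) := by
  rw [geomLaw, lintegral_sum_measure]
  congr 1
  funext k
  rw [lintegral_smul_measure, lintegral_dirac, smul_eq_mul]

/-- The geometric weights are summable. -/
theorem summable_geomWeight : Summable geomWeight := by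
  unfold geomWeight
  simpa [pow_succ] using (summable_geometric_two.mul_right (1 / 2 : ℝ))

/-- The geometric weights sum to `1`. -/
theorem tsum_geomWeight : ∑' k, geomWeight k = 1 := by
  unfold geomWeight
  have h : ∀ k : ℕ, (1 / 2 : ℝ) ^ (k + 1) = (1 : ℝ) / 2 / 2 ^ k := by
    intro k
    rw [pow_succ, one_div_pow]
    ring
  simp_rw [h]
  exact tsum_geometric_two' 1

/-- The geometric law is a probability measure. -/
instance isProbabilityMeasure_geomLaw : IsProbabilityMeasure geomLaw := by
  refine ⟨?_⟩
  rw [← lintegral_one, lintegral_geomLaw]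
  simp only [mul_one]
  rw [← ENNReal.ofReal_tsum_of_nonneg (fun k => (geomWeight_pos k).le) summable_geomWeight,
    tsum_geomWeight, ENNReal.ofReal_one]

/-- The `p`-th moment summand `2^{-(k+1)} (k+1)^p` is summable. -/
theorem summable_geomWeight_mul_pow (p : ℕ) :
    Summable fun k : ℕ => geomWeight k * ((k : ℝ) + 1) ^ p := by
  have h := summable_pow_mul_geometric_of_norm_lt_one p
    (show ‖(1 / 2 : ℝ)‖ < 1 by rw [Real.norm_eq_abs, abs_of_pos (by norm_num)]; norm_num)
  -- shift by one: k ↦ k + 1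
  have h1 : Summable fun k : ℕ => (((k + 1 : ℕ) : ℝ)) ^ p * (1 / 2 : ℝ) ^ (k + 1) :=
    (summable_nat_add_iff 1).2 h
  refine h1.congr fun k => ?_
  unfold geomWeight
  push_cast
  ring

/-- **Every moment of the geometric law is finite.** -/
theorem lintegral_pow_geomLaw_ne_top (p : ℕ) :
    ∫⁻ y, ENNReal.ofReal (|y| ^ p) ∂geomLaw ≠ ∞ := by
  rw [lintegral_geomLaw]
  have h : ∀ k : ℕ, ENNReal.ofReal (geomWeight k) * ENNReal.ofReal (|(k : ℝ) + 1| ^ p) =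
      ENNReal.ofReal (geomWeight k * ((k : ℝ) + 1) ^ p) := by
    intro k
    rw [abs_of_nonneg (by positivity), ← ENNReal.ofReal_mul (geomWeight_pos k).le]
  simp_rw [h]
  rw [← ENNReal.ofReal_tsum_of_nonneg (fun k => mul_nonneg (geomWeight_pos k).le (by positivity))
    (summable_geomWeight_mul_pow p)]
  exact ENNReal.ofReal_ne_top

/-- The tail summands of the geometric law. -/
def geomTerm (k : ℕ) : ℝ≥0∞ := ENNReal.ofReal (geomWeight k * ((k : ℝ) + 1))

/-- The tail series of the geometric law converges. -/
theorem tsum_geomTerm_ne_top : ∑' k, geomTerm k ≠ ∞ := by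
  unfold geomTerm
  rw [← ENNReal.ofReal_tsum_of_nonneg (fun k => mul_nonneg (geomWeight_pos k).le (by positivity))
    (by simpa using summable_geomWeight_mul_pow 1)]
  exact ENNReal.ofReal_ne_top

/-- The tail of the geometric law above an INTEGER threshold `m` is the shifted series. -/
theorem lawTail_geomLaw_nat (m : ℕ) : lawTail geomLaw (m : ℝ) = ∑' j : ℕ, geomTerm (j + m) := by
  rw [lawTail, lintegral_geomLaw]
  set g : ℕ → ℝ≥0∞ := fun k => ENNReal.ofReal (geomWeight k) * ENNReal.ofReal (tailFn (m : ℝ) ((k : ℝ) + 1))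
  have hsplit := (ENNReal.summable (f := fun j => g (j + m))).sum_add_tsum_nat_add'
  rw [← hsplit]
  have hzero : ∑ i ∈ Finset.range m, g i = 0 := by
    refine Finset.sum_eq_zero fun i hi => ?_
    have hi' : (i : ℝ) + 1 ≤ m := by exact_mod_cast Finset.mem_range.1 hi
    simp only [g, tailFn_of_le hi', ENNReal.ofReal_zero, mul_zero]
  rw [hzero, zero_add]
  refine tsum_congr fun j => ?_
  have hlt : (m : ℝ) < ((j + m : ℕ) : ℝ) + 1 := by push_cast; linarith [(Nat.cast_nonneg j : (0 : ℝ) ≤ j)]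
  simp only [g, geomTerm, tailFn_of_lt hlt]
  rw [← ENNReal.ofReal_mul (geomWeight_pos _).le]

/-- **UI holds for the geometric law** (a single integrable law is uniformly integrable). -/
theorem uiShape_geomLaw : UIShape (fun V _ _ => lawTail geomLaw V) := by
  intro ε hε
  have ht := ENNReal.tendsto_sum_nat_add geomTerm tsum_geomTerm_ne_top
  have hev : ∀ᶠ m : ℕ in atTop, ∑' j, geomTerm (j + m) ≤ ENNReal.ofReal ε := by
    refine (ht.eventually (ge_mem_nhds ?_))
    exact ENNReal.ofReal_pos.2 hε
  obtain ⟨m, hm⟩ := hev.exists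
  refine ⟨(m : ℝ), 1, one_pos, fun τ _ => ⟨0, fun N _ => ?_⟩⟩
  simp only
  rw [lawTail_geomLaw_nat m]
  exact hm

/-- **The tail of the geometric law never dies**: above every threshold `V` it is at least
`2^{-(⌈V⌉₊+1)}`. -/
theorem geomTerm_le_lawTail_geomLaw (V : ℝ) :
    ENNReal.ofReal (geomWeight ⌈V⌉₊) ≤ lawTail geomLaw V := by
  rw [lawTail, lintegral_geomLaw]
  refine le_trans ?_ (ENNReal.le_tsum ⌈V⌉₊)
  have hlt : V < (⌈V⌉₊ : ℝ) + 1 := by linarith [Nat.le_ceil V]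
  rw [tailFn_of_lt hlt, ← ENNReal.ofReal_mul (geomWeight_pos _).le]
  refine ENNReal.ofReal_le_ofReal ?_
  have h1 : (1 : ℝ) ≤ (⌈V⌉₊ : ℝ) + 1 := by linarith [(Nat.cast_nonneg ⌈V⌉₊ : (0 : ℝ) ≤ ⌈V⌉₊)]
  nlinarith [geomWeight_pos ⌈V⌉₊]

/-- **The crux shape fails for the geometric law.** -/
theorem not_cruxShape_geomLaw : ¬ CruxShape (fun V _ _ => lawTail geomLaw V) := by
  rintro ⟨V₀, -, h⟩
  set c : ℝ := geomWeight ⌈V₀⌉₊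
  have hc0 : 0 < c := geomWeight_pos _
  obtain ⟨τ₀, -, h⟩ := h V₀ le_rfl (c / 2) (half_pos hc0)
  obtain ⟨N₀, hN⟩ := h τ₀ le_rfl
  have key := hN N₀ le_rfl
  simp only at key
  have hlow := geomTerm_le_lawTail_geomLaw V₀
  have : ENNReal.ofReal c ≤ ENNReal.ofReal (c / 2) := hlow.trans key
  have := (ENNReal.ofReal_le_ofReal_iff (half_pos hc0).le).1 this
  linarith

/-- **Any proof must produce CONCENTRATION, not moments.**  There is a family of probability laws
(constant in `τ, N`: the geometric law) with every moment bounded uniformly and the UI shape,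
for which the crux shape fails.  Hence no estimate of the form `sup_{τ,N} E[aᵢ^p] ≤ C_p`
(`p` arbitrary), and not even uniform integrability of the window activities, can imply
`CollisionActivityTails`: the crux is a law of large numbers in the window length `τ` for the
tagged-particle activity under the TRUE law (its limit points must be essentially bounded by
`V₀`), exactly the "one-particle LLN in `τ`" the planners mention — which is therefore not a
garnish but the whole content at equilibrium. -/
theorem exists_uiShape_moments_not_cruxShape :
    ∃ ν : ℝ → ℕ → Measure ℝ, (∀ τ N, IsProbabilityMeasure (ν τ N)) ∧
      (∀ p : ℕ, ∃ C : ℝ≥0∞, C ≠ ∞ ∧ ∀ τ N, ∫⁻ y, ENNReal.ofReal (|y| ^ p) ∂(ν τ N) ≤ C) ∧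
      UIShape (fun V τ N => lawTail (ν τ N) V) ∧ ¬ CruxShape (fun V τ N => lawTail (ν τ N) V) :=
  ⟨fun _ _ => geomLaw, fun _ _ => isProbabilityMeasure_geomLaw,
    fun p => ⟨_, lintegral_pow_geomLaw_ne_top p, fun _ _ => le_rfl⟩,
    uiShape_geomLaw, not_cruxShape_geomLaw⟩



/-! ### §3c The crux IS of crux shape (so §3a–§3b apply to it verbatim) -/

/-- `CollisionActivityTails` is, data by data, the statement `CruxShape E` for the tail functional
`E V τ N = sup_{s ∈ [0,t]} E_{λ_N}[activityTail N V (a(s))]`. -/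
theorem collisionActivityTails_iff_cruxShape :
    Summit.AtomisticToContinuum.HydrodynamicLimit.Theses.TwoClocks.CollisionActivityTails ↔
    ∀ (a₀ θ₀ : T3 → ℝ) (u₀ : T3 → V3), Continuous a₀ → Continuous θ₀ → Continuous u₀ →
      (∀ x, 0 < a₀ x) → (∀ x, 0 < θ₀ x) → ∃ σ₀ : ℝ, 0 < σ₀ ∧ ∀ σ : ℝ, 0 < σ → σ < σ₀ →
      ∀ (T : ℝ) (ρ θ : ℝ → T3 → ℝ) (u : ℝ → T3 → V3), IsHardSphereEulerSolution σ T ρ u θ →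
      ∀ Φ : (N : ℕ) → Flow σ N,
      TendstoHydroFieldsAt (fun N => localGibbsLaw σ a₀ u₀ θ₀ N (Φ N)) Φ ρ u θ 0 →
      ∀ t ∈ Set.Ico 0 T,
        CruxShape fun V τ N => ⨆ s ∈ Set.Icc 0 t,
          ∫⁻ z, ENNReal.ofReal (activityTail N V
            (fun i => activity (Φ N) τ (Set.Ioc s (s + window τ N)) i z))
          ∂(localGibbsLaw σ a₀ u₀ θ₀ N (Φ N)) := by
  simp only [collisionActivityTails_iff, CruxShape, iSup₂_le_iff]

/-! ## §4 Load-bearing hypotheses (typed variants; verdicts on paper, see the docstrings)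

None of the variants below can be CLOSED in Lean today, in either direction: each needs a
quantitative LOWER bound on the collision frequency of a tagged sphere under the hard-sphere flow
started from a Gibbs law (the tree's flow API — `HardSphereFlow`, Alexander's theorem
`HardSphereFlow.nonempty_torus_holds`, Liouville invariance — is qualitative: existence,
invariance, a.e. uniqueness; no recurrence / collision-rate bound).  They are recorded as typed
targets with their paper verdicts so that nobody re-derives them. -/

/-- The crux WITHOUT THE THRESHOLD (`V = 0`): the MEAN window activity vanishes,
`E_{λ_N}[(N+1)⁻¹ Σᵢ aᵢ(s)] → 0` (`activityTail_zero`).  PAPER-FALSE already at global equilibrium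
(constant profiles, `T` arbitrary): by the virial theorem the Gibbs mean of `aᵢ` is
`6 θ₀ (Z(σ³) − 1) = 4π σ³ θ₀ g(σ⁺) > 0` for every window (each collision is counted for BOTH
partners: `(Z−1)θ = (ε_N/3)·(collisions per particle per unit time, counted once)·E|Δv|`, so
`E aᵢ = (σ/τ)·w·2·3(Z−1)θ₀/ε_N = 6(Z−1)θ₀`; the route text's `3θ₀(Z−1)` is off by this factor `2` —
harmless for the crux, where `V₀` is existential, but the companion crux 13733's side remark
"V₀ > 3θ₀(Z−1)" should read `6θ₀(Z−1)`).  So `V₀ > 0` is load-bearing: ANY PROOF MUST USE THE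
THRESHOLD. -/
def CollisionActivityTailsNoThreshold : Prop :=
  ∀ (a₀ θ₀ : T3 → ℝ) (u₀ : T3 → V3), Continuous a₀ → Continuous θ₀ → Continuous u₀ →
    (∀ x, 0 < a₀ x) → (∀ x, 0 < θ₀ x) → ∃ σ₀ : ℝ, 0 < σ₀ ∧ ∀ σ : ℝ, 0 < σ → σ < σ₀ →
    ∀ (T : ℝ) (ρ θ : ℝ → T3 → ℝ) (u : ℝ → T3 → V3), IsHardSphereEulerSolution σ T ρ u θ →
    ∀ Φ : (N : ℕ) → Flow σ N,
    TendstoHydroFieldsAt (fun N => localGibbsLaw σ a₀ u₀ θ₀ N (Φ N)) Φ ρ u θ 0 →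
    ∀ t ∈ Set.Ico 0 T, ∀ ε : ℝ, 0 < ε →
    ∃ τ₀ : ℝ, 0 < τ₀ ∧ ∀ τ : ℝ, τ₀ ≤ τ → ∃ N₀ : ℕ, ∀ N : ℕ, N₀ ≤ N → ∀ s ∈ Set.Icc 0 t,
      ∫⁻ z, ENNReal.ofReal (activityTail N 0
          (fun i => activity (Φ N) τ (Set.Ioc s (s + window τ N)) i z))
        ∂(localGibbsLaw σ a₀ u₀ θ₀ N (Φ N)) ≤ ENNReal.ofReal ε

/-- The no-threshold variant implies the crux (thresholds only shrink the tail): so it is a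
STRENGTHENING, and its paper refutation above does not touch the crux. -/
theorem collisionActivityTails_of_noThreshold (h : CollisionActivityTailsNoThreshold)
    (hnonneg : ∀ (σ : ℝ), 0 < σ → ∀ (N : ℕ) (Φ : Flow σ N) (τ : ℝ), 0 < τ → ∀ (S : Set ℝ)
      (i : Fin (N + 1)) (z : Cfg N), 0 ≤ activity Φ τ S i z) :
    Summit.AtomisticToContinuum.HydrodynamicLimit.Theses.TwoClocks.CollisionActivityTails := by
  rw [collisionActivityTails_iff]
  intro a₀ θ₀ u₀ ha hθ hu ha0 hθ0
  obtain ⟨σ₀, hσ₀, h⟩ := h a₀ θ₀ u₀ ha hθ hu ha0 hθ0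
  refine ⟨σ₀, hσ₀, fun σ hσ hσσ₀ T ρ θ u hsol Φ hLLN t ht => ⟨1, one_pos, fun V hV ε hε => ?_⟩⟩
  obtain ⟨τ₀, hτ₀, h⟩ := h σ hσ hσσ₀ T ρ θ u hsol Φ hLLN t ht ε hε
  refine ⟨τ₀, hτ₀, fun τ hτ => ?_⟩
  obtain ⟨N₀, h⟩ := h τ hτ
  refine ⟨N₀, fun N hN s hs => le_trans (lintegral_mono fun z => ENNReal.ofReal_le_ofReal ?_)
    (h N hN s hs)⟩
  exact activityTail_anti (le_trans zero_le_one hV)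
    (fun i => hnonneg σ hσ N (Φ N) τ (hτ₀.trans_le hτ) _ i z)

/-- The nonnegativity side condition of `collisionActivityTails_of_noThreshold` holds. -/
theorem activity_nonneg' (σ : ℝ) (hσ : 0 < σ) (N : ℕ) (Φ : Flow σ N) (τ : ℝ) (hτ : 0 < τ)
    (S : Set ℝ) (i : Fin (N + 1)) (z : Cfg N) : 0 ≤ activity Φ τ S i z :=
  activity_nonneg hσ.le hτ.le Φ S i z

/-- The crux FOR ALL WINDOWS (`∀ τ > 0` in place of `∃ τ₀ ∀ τ ≥ τ₀`).  PAPER-FALSE at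
equilibrium: for `τ π σ² √θ₀ ≪ 1` the window `w = τ(N+1)^{-1/3}` is a small fraction of a mean free
time, a particle has at most one collision in it with probability `1 − O(τσ²)`, and when it has one
its activity is `(σ/τ)|Δv| ≫ V` for `τ ≪ σ√θ₀/V`; so the tail above `V` equals the full mean
`6θ₀(Z−1)(1 − o(1))` and does not vanish as `N → ∞`.  Hence the long-window limit `τ → ∞`
(many mean free times: the time average) is load-bearing: ANY PROOF MUST AVERAGE OVER MANY
COLLISIONS of the tagged particle. -/
def CollisionActivityTailsAllWindows : Prop :=
  ∀ (a₀ θ₀ : T3 → ℝ) (u₀ : T3 → V3), Continuous a₀ → Continuous θ₀ → Continuous u₀ →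
    (∀ x, 0 < a₀ x) → (∀ x, 0 < θ₀ x) → ∃ σ₀ : ℝ, 0 < σ₀ ∧ ∀ σ : ℝ, 0 < σ → σ < σ₀ →
    ∀ (T : ℝ) (ρ θ : ℝ → T3 → ℝ) (u : ℝ → T3 → V3), IsHardSphereEulerSolution σ T ρ u θ →
    ∀ Φ : (N : ℕ) → Flow σ N,
    TendstoHydroFieldsAt (fun N => localGibbsLaw σ a₀ u₀ θ₀ N (Φ N)) Φ ρ u θ 0 →
    ∀ t ∈ Set.Ico 0 T, ∃ V₀ : ℝ, 0 < V₀ ∧ ∀ V : ℝ, V₀ ≤ V → ∀ ε : ℝ, 0 < ε →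
    ∀ τ : ℝ, 0 < τ → ∃ N₀ : ℕ, ∀ N : ℕ, N₀ ≤ N → ∀ s ∈ Set.Icc 0 t,
      ∫⁻ z, ENNReal.ofReal (activityTail N V
          (fun i => activity (Φ N) τ (Set.Ioc s (s + window τ N)) i z))
        ∂(localGibbsLaw σ a₀ u₀ θ₀ N (Φ N)) ≤ ENNReal.ofReal ε

/-- The all-windows variant implies the crux (take `τ₀ = 1`): again a strengthening. -/
theorem collisionActivityTails_of_allWindows (h : CollisionActivityTailsAllWindows) :
    Summit.AtomisticToContinuum.HydrodynamicLimit.Theses.TwoClocks.CollisionActivityTails := by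
  rw [collisionActivityTails_iff]
  intro a₀ θ₀ u₀ ha hθ hu ha0 hθ0
  obtain ⟨σ₀, hσ₀, h⟩ := h a₀ θ₀ u₀ ha hθ hu ha0 hθ0
  refine ⟨σ₀, hσ₀, fun σ hσ hσσ₀ T ρ θ u hsol Φ hLLN t ht => ?_⟩
  obtain ⟨V₀, hV₀, h⟩ := h σ hσ hσσ₀ T ρ θ u hsol Φ hLLN t ht
  refine ⟨V₀, hV₀, fun V hV ε hε => ⟨1, one_pos, fun τ hτ => h V hV ε hε τ (one_pos.trans_le hτ)⟩⟩

/-! ### §4b Hypotheses that are NOT load-bearing (reading of the statement)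

* The Euler solution `(ρ, u, θ)` and the LLN hypothesis at `t = 0` enter the conclusion ONLY
  through the horizon `t < T`: the item is a pure a priori estimate on `(a₀, u₀, θ₀, σ, Φ, t)`
  (same structural remark as for EnergyCurrentTails, stmt-9235).  In particular NO USE can be made
  of smoothness of the hydrodynamic fields in a proof, except through `T`.
* `Φ`: hard-sphere flows agree Liouville-a.e. (`HardSphereUniqueness`), `λ_N ≪` Liouville
  (`localGibbsMeasure_absolutelyContinuous`), and `collisionSum` is DERIVED from the orbit
  (`HardSphereFlow.collisionSum` is a `finsum` over the orbit's collision times, not a free field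
  of the structure): the junk-model attack on `∀ Φ` fails, the dependence on `Φ` is fictitious.
* `σ` large is not excluded by falsity but by vacuity: once the spheres cannot fit, `λ_N = 0` and
  the conclusion holds trivially; `T ≤ 0` is vacuous; `N₀` absorbs small `N`.
* The tail currency `L¹` (not exponential) is forced: the dense-blob witness that refuted
  ex-crux stmt-14441 (an fcc blob of a fraction `α` of the spheres at gap `δ′`, Gibbs cost
  `e^{-cαN}`, activity `≍ θ₀/δ′` each) shows `P_G(activityTail > S) ≥ e^{-C(S)N}`, so NO
  exponential-in-`N` concentration of the activity tail holds even at equilibrium; only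
  `E[tail] → 0` can be true.  (Recorded; the blob does not bite the `L¹` statement because its
  probability vanishes.) -/

/-! ## §5 The equilibrium rung (where any real counterexample must live first)

At constant profiles the local Gibbs law is the boosted canonical Gibbs measure, whose density is a
function of the conserved energy and momentum on the hard-sphere domain, hence invariant under every
hard-sphere flow; the law at time `s` is the law at time `0` and the crux collapses to the
following `s`-free statement.  It is the cheapest typed rung of the crux (its negation refutes the
crux MODULO the equilibrium LLN `localGibbs_densityLLN`, still open in the tree, which is needed to
discharge the crux's `TendstoHydroFieldsAt` hypothesis at constant data). -/

/-- **Equilibrium activity tails** (profile-wise `σ₀`, as in the crux).  Under the canonical Gibbs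
law with constant profiles the window activity over `(0, w]` has vanishing `L¹` tail above every
`V ≥ V₀`, as `τ → ∞` after `N → ∞`.  Heuristically TRUE: a tagged sphere with activity `> V` over `τ′ = τπσ²√θ₀ → ∞` mean free
times must sit, for a positive fraction of the window, in a cage of gap `δ′ ≲ θ₀/V`, and a cage
surviving a time `fw` needs a jammed droplet of `≳ (f τ √θ₀ / σ)³` members (evaporation front at
thermal speed), of Gibbs probability `exp(-c (fτ/σ)³)`; free-volume integration in `δ′` converges.
A PROOF needs exactly the missing dynamical lower bound of §4 in contrapositive form ("sustained
activity forces a large droplet"), i.e. a deterministic many-body statement of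
Burago–Ferleger–Kononenko type localised in time — not in the literature for gases. -/
def EquilibriumCollisionActivityTails : Prop :=
  ∀ (a₀ θ₀ : ℝ) (u₀ : V3), 0 < a₀ → 0 < θ₀ → ∃ σ₀ : ℝ, 0 < σ₀ ∧ ∀ σ : ℝ, 0 < σ → σ < σ₀ →
    ∀ Φ : (N : ℕ) → Flow σ N, ∃ V₀ : ℝ, 0 < V₀ ∧ ∀ V : ℝ, V₀ ≤ V → ∀ ε : ℝ, 0 < ε →
    ∃ τ₀ : ℝ, 0 < τ₀ ∧ ∀ τ : ℝ, τ₀ ≤ τ → ∃ N₀ : ℕ, ∀ N : ℕ, N₀ ≤ N →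
      ∫⁻ z, ENNReal.ofReal (activityTail N V
          (fun i => activity (Φ N) τ (Set.Ioc 0 (window τ N)) i z))
        ∂(localGibbsLaw σ (fun _ => a₀) (fun _ => u₀) (fun _ => θ₀) N (Φ N)) ≤ ENNReal.ofReal ε

/-! ### §5b The crux implies the equilibrium rung, modulo the constant-density LLN

The crux's hypotheses are dischargeable at constant data: constant states are classical
hard-sphere-Euler solutions on every `[0, T)` (`isHardSphereEulerSolution_const`, from the
Literature `IsHardSphereEulerSolutionDim.const`), and the `t = 0` LLN for constant profiles holds
with a CONSTANT limiting density (`ConstantProfileLLN` below: the tree's `localGibbs_lln_holds`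
gives the LLN with SOME continuous `ρ₀ > 0`; that `ρ₀` is constant for constant activity follows
from the exposed witness `rhoLim (profileOf a₀) σ` of `HardSphereEulerLLN` — `β` constant — and is
PROVED in §5c, `constantProfileLLN_holds`).  Then `t = 0`, `s = 0` of the crux IS the rung, and the
reduction is unconditional (`equilibriumCollisionActivityTails_of_crux'`,
`not_collisionActivityTails_of_not_equilibrium`; axioms `propext, Classical.choice, Quot.sound`). -/

/-- Constant states are classical hard-sphere-Euler solutions (every `σ`, every `T`). -/
theorem isHardSphereEulerSolution_const (σ T : ℝ) {ρ₀ θ₀ : ℝ} (u₀ : V3) (hρ : 0 < ρ₀)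
    (hθ : 0 < θ₀) :
    IsHardSphereEulerSolution σ T (fun _ _ => ρ₀) (fun _ _ => u₀) (fun _ _ => θ₀) :=
  isHardSphereEulerSolutionDim_three_iff.1 (IsHardSphereEulerSolutionDim.const σ T u₀ hρ hθ)

/-- **The constant-profile LLN with constant density** (proved below, `constantProfileLLN_holds`;
kept as a named hypothesis so that the reduction's logic is visible). -/
def ConstantProfileLLN : Prop :=
  ∀ (a₀ θ₀ : ℝ) (u₀ : V3), 0 < a₀ → 0 < θ₀ → ∃ σ₁ : ℝ, 0 < σ₁ ∧ ∀ σ : ℝ, 0 < σ → σ < σ₁ →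
    ∃ r : ℝ, 0 < r ∧ ∀ Φ : (N : ℕ) → Flow σ N,
      TendstoHydroFieldsAt (fun N => localGibbsLaw σ (fun _ => a₀) (fun _ => u₀) (fun _ => θ₀) N (Φ N))
        Φ (fun _ _ => r) (fun _ _ => u₀) (fun _ _ => θ₀) 0

/-- **Reduction: the crux implies the equilibrium rung** (modulo `ConstantProfileLLN`).  Hence any
counterexample to `EquilibriumCollisionActivityTails` — persistent caging of a tagged sphere in the
global Gibbs state with non-vanishing activity-weighted probability — refutes the crux. -/
theorem equilibriumCollisionActivityTails_of_crux (hL : ConstantProfileLLN)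
    (h : Summit.AtomisticToContinuum.HydrodynamicLimit.Theses.TwoClocks.CollisionActivityTails) :
    EquilibriumCollisionActivityTails := by
  rw [collisionActivityTails_iff] at h
  intro a₀ θ₀ u₀ ha hθ
  obtain ⟨σc, hσc, hc⟩ := h (fun _ => a₀) (fun _ => θ₀) (fun _ => u₀) continuous_const
    continuous_const continuous_const (fun _ => ha) (fun _ => hθ)
  obtain ⟨σ₁, hσ₁, hl⟩ := hL a₀ θ₀ u₀ ha hθ
  refine ⟨min σc σ₁, lt_min hσc hσ₁, fun σ hσ hσlt Φ => ?_⟩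
  have hσc' : σ < σc := hσlt.trans_le (min_le_left _ _)
  have hσ₁' : σ < σ₁ := hσlt.trans_le (min_le_right _ _)
  obtain ⟨r, hr, hlln⟩ := hl σ hσ hσ₁'
  obtain ⟨V₀, hV₀, H⟩ := hc σ hσ hσc' 1 (fun _ _ => r) (fun _ _ => θ₀) (fun _ _ => u₀)
    (isHardSphereEulerSolution_const σ 1 u₀ hr hθ) Φ (hlln Φ) 0 ⟨le_rfl, one_pos⟩
  refine ⟨V₀, hV₀, fun V hV ε hε => ?_⟩
  obtain ⟨τ₀, hτ₀, H⟩ := H V hV ε hε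
  refine ⟨τ₀, hτ₀, fun τ hτ => ?_⟩
  obtain ⟨N₀, H⟩ := H τ hτ
  refine ⟨N₀, fun N hN => ?_⟩
  have key := H N hN 0 ⟨le_rfl, le_rfl⟩
  simpa only [zero_add] using key

/-! ### §5c Discharging `ConstantProfileLLN`: the reduction is unconditional

Port (with attribution) of the identification argument of `Cruxes/DenseExcursion/Disproof.lean` §2
(refuter-cdisprove-stmt-AtomisticToContinuum-12586): the tree's density LLN with its witness
`rhoLim (profileOf a₀) σ` exposed (`densityLLN_rhoLim`), uniqueness of limits in probability
(`eq_of_tendsto_measure_lt`), identification of continuous densities by their integrals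
(`eq_of_forall_integral_mul_eq`); for CONSTANT activity `β ≡ 1/vol = const`, so `rhoLim` is a
constant function (`rhoLim_const`), and the `ρ₀` of `localGibbs_lln_holds` IS that constant. -/

section ConstantLLN

open Literature.MathematicalPhysics.StatisticalMechanics

/-- **Limits in probability are unique** (eventually-probability laws): if the laws of `F N`
concentrate at `a` and at `b` then `a = b`. (Ported from the DenseExcursion disproof file.) -/
theorem eq_of_tendsto_measure_lt {Ω : ℕ → Type*} [∀ N, MeasurableSpace (Ω N)]
    {P : (N : ℕ) → Measure (Ω N)} (hP : ∀ᶠ N in atTop, IsProbabilityMeasure (P N))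
    {E : Type*} [NormedAddCommGroup E] {F : (N : ℕ) → Ω N → E} {a b : E}
    (ha : ∀ δ > (0 : ℝ), Tendsto (fun N => P N {z | δ < ‖F N z - a‖}) atTop (𝓝 0))
    (hb : ∀ δ > (0 : ℝ), Tendsto (fun N => P N {z | δ < ‖F N z - b‖}) atTop (𝓝 0)) : a = b := by
  by_contra hab
  have hd : 0 < ‖a - b‖ := norm_pos_iff.2 (sub_ne_zero.2 hab)
  set δ := ‖a - b‖ / 3 with hδ
  have hδ0 : 0 < δ := by positivity
  have hcover : ∀ N, (univ : Set (Ω N)) ⊆ {z | δ < ‖F N z - a‖} ∪ {z | δ < ‖F N z - b‖} := by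
    intro N z _
    by_contra hz
    simp only [Set.mem_union, Set.mem_setOf_eq, not_or, not_lt] at hz
    have : ‖a - b‖ ≤ ‖F N z - a‖ + ‖F N z - b‖ := by
      calc ‖a - b‖ = ‖(F N z - b) - (F N z - a)‖ := by congr 1; abel
        _ ≤ ‖F N z - b‖ + ‖F N z - a‖ := norm_sub_le _ _
        _ = ‖F N z - a‖ + ‖F N z - b‖ := add_comm _ _
    linarith [hz.1, hz.2]
  have hle : ∀ᶠ N in atTop,
      (1 : ℝ≥0∞) ≤ P N {z | δ < ‖F N z - a‖} + P N {z | δ < ‖F N z - b‖} := by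
    filter_upwards [hP] with N hPN
    calc (1 : ℝ≥0∞) = P N univ := measure_univ.symm
      _ ≤ P N ({z | δ < ‖F N z - a‖} ∪ {z | δ < ‖F N z - b‖}) := measure_mono (hcover N)
      _ ≤ _ := measure_union_le _ _
  have hlim : Tendsto (fun N => P N {z | δ < ‖F N z - a‖} + P N {z | δ < ‖F N z - b‖})
      atTop (𝓝 0) := by
    simpa using (ha δ hδ0).add (hb δ hδ0)
  have h10 : (1 : ℝ≥0∞) ≤ 0 := ge_of_tendsto hlim hle
  exact absurd h10 (by simp)

/-- Real-valued version of `eq_of_tendsto_measure_lt`. -/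
theorem eq_of_tendsto_measure_lt_abs {Ω : ℕ → Type*} [∀ N, MeasurableSpace (Ω N)]
    {P : (N : ℕ) → Measure (Ω N)} (hP : ∀ᶠ N in atTop, IsProbabilityMeasure (P N))
    {F : (N : ℕ) → Ω N → ℝ} {a b : ℝ}
    (ha : ∀ δ > (0 : ℝ), Tendsto (fun N => P N {z | δ < |F N z - a|}) atTop (𝓝 0))
    (hb : ∀ δ > (0 : ℝ), Tendsto (fun N => P N {z | δ < |F N z - b|}) atTop (𝓝 0)) : a = b :=
  eq_of_tendsto_measure_lt (E := ℝ) hP (by simpa only [Real.norm_eq_abs] using ha)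
    (by simpa only [Real.norm_eq_abs] using hb)

/-- Two continuous functions on `𝕋³` with the same integrals against every continuous test
function are equal. (Ported from the DenseExcursion disproof file.) -/
theorem eq_of_forall_integral_mul_eq {f g : T3 → ℝ} (hf : Continuous f) (hg : Continuous g)
    (h : ∀ χ : T3 → ℝ, Continuous χ → ∫ x, χ x * f x = ∫ x, χ x * g x) : f = g := by
  have hw : Continuous fun x => f x - g x := hf.sub hg
  have h1 := h _ hw
  have hint : ∫ x, (f x - g x) ^ 2 = 0 := by
    have hi1 : Integrable (fun x => (f x - g x) * f x) := integrable_of_continuous_T3 (hw.mul hf)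
    have hi2 : Integrable (fun x => (f x - g x) * g x) := integrable_of_continuous_T3 (hw.mul hg)
    have h2 : ∫ x, ((f x - g x) * f x - (f x - g x) * g x) = 0 := by
      rw [integral_sub hi1 hi2, h1, sub_self]
    have e : (fun x => (f x - g x) ^ 2) = fun x => (f x - g x) * f x - (f x - g x) * g x := by
      funext x; ring
    rw [e]
    exact h2
  have hae : (fun x => (f x - g x) ^ 2) =ᵐ[volume] 0 :=
    (integral_eq_zero_iff_of_nonneg (fun x => sq_nonneg (f x - g x))
      (integrable_of_continuous_T3 (hw.pow 2))).1 hint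
  have heq : (fun x => (f x - g x) ^ 2) = 0 :=
    (Continuous.ae_eq_iff_eq volume (hw.pow 2) continuous_const).1 hae
  funext x
  have hx := congrFun heq x
  simp only [Pi.zero_apply, ne_eq, OfNat.ofNat_ne_zero, not_false_eq_true, pow_eq_zero_iff] at hx
  linarith

/-- **The density LLN with the IDENTIFIED limit `rhoLim`** (the tree's `localGibbs_densityLLN_holds`
with its witness exposed; ported from the DenseExcursion disproof file). -/
theorem densityLLN_rhoLim {a₀ : T3 → ℝ} (ha : Continuous a₀) (ha0 : ∀ x, 0 < a₀ x) :
    ∃ σ₀ : ℝ, 0 < σ₀ ∧ ∀ σ : ℝ, 0 < σ → σ < σ₀ →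
      SmallDensity (profileOf a₀ ha ha0) σ ∧
      (∀ x, 4 * Real.exp 1 * (profileOf a₀ ha ha0).M * geomRatio (profileOf a₀ ha ha0) σ /
          (1 - geomRatio (profileOf a₀ ha ha0) σ) < (profileOf a₀ ha ha0).β x) ∧
      ∀ χ : T3 → ℝ, Continuous χ → ∀ δ > (0 : ℝ),
        Tendsto (fun N : ℕ => posGibbsMeasure a₀ (hsDiameter σ N) (N + 1)
          {x | δ < |((N + 1 : ℕ) : ℝ)⁻¹ * ∑ i, χ (x i) -
            ∫ y, χ y * rhoLim (profileOf a₀ ha ha0) σ y|}) atTop (𝓝 0) := by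
  set P := profileOf a₀ ha ha0 with hP
  obtain ⟨x₀, -, hx₀⟩ := isCompact_univ.exists_isMinOn univ_nonempty P.continuous.continuousOn
  have hβmin : ∀ y, P.β x₀ ≤ P.β y := fun y => (isMinOn_iff.mp hx₀) y (mem_univ y)
  obtain ⟨σ₀, hσ₀, hsmall⟩ := exists_smallDensity P (P.pos x₀)
  refine ⟨σ₀, hσ₀, fun σ hσ hσσ₀ => ?_⟩
  obtain ⟨h, hpos⟩ := hsmall σ hσ hσσ₀
  refine ⟨h, fun x => hpos.trans_le (hβmin x), ?_⟩
  intro χ hχ δ hδ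
  obtain ⟨C, hC0, hχC⟩ := exists_forall_abs_le_of_continuous hχ
  have hχm : Measurable χ := hχ.measurable
  rw [← h.Ilim_eq_integral hχ]
  set I := Ilim P σ χ with hI
  set V : ℕ → ℝ := fun N => (∫ x, ((((N + 1 : ℕ) : ℝ))⁻¹ * ∑ i, χ (x i) - I) ^ 2 *
      efR (Ov (hsDiameter σ N)) x Finset.univ
        ∂Measure.pi (fun _ : Fin (N + 1) => P.μ)) / XiN P σ N (N + 1) with hV
  have hVlim : Tendsto V atTop (𝓝 0) := h.tendsto_variance hχ
  have hbound : ∀ N : ℕ, posGibbsMeasure a₀ (hsDiameter σ N) (N + 1)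
      {x | δ < |((N + 1 : ℕ) : ℝ)⁻¹ * ∑ i, χ (x i) - I|} ≤ ENNReal.ofReal (V N / δ ^ 2) := by
    intro N
    have hXi := XiN_pos h.σ_pos.le h.σ_lt_half h.ovDensity_lt_one (N := N) (m := N + 1) le_rfl
    have hA : Measurable fun x : Fin (N + 1) → T3 => ((N + 1 : ℕ) : ℝ)⁻¹ * ∑ i, χ (x i) :=
      (Finset.measurable_sum _ fun i _ => hχm.comp (measurable_pi_apply i)).const_mul _
    have hAK : ∀ x : Fin (N + 1) → T3,
        |((N + 1 : ℕ) : ℝ)⁻¹ * ∑ i, χ (x i)| ≤ ((N + 1 : ℕ) : ℝ)⁻¹ * ((N + 1 : ℕ) * C) :=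
      fun x => by
        rw [abs_mul, abs_of_nonneg (by positivity)]
        exact mul_le_mul_of_nonneg_left (abs_sum_apply_le hχC x) (by positivity)
    have hXi' : 0 ≤ (Xi P (hsDiameter σ N) (N + 1) (N + 1))⁻¹ := inv_nonneg.2 hXi.le
    rw [posGibbsMeasure_eq ha ha0, Measure.smul_apply, smul_eq_mul]
    refine (mul_le_mul_right (restrict_hardCore_deviation_le P _ _ hA hAK I hδ) _).trans
      (le_of_eq ?_)
    rw [← ENNReal.ofReal_mul hXi']
    congr 1
    rw [hV]
    dsimp only
    rw [XiN, inv_mul_eq_div, div_div, div_div, mul_comm]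
  have hlim : Tendsto (fun N => ENNReal.ofReal (V N / δ ^ 2)) atTop (𝓝 0) := by
    have := ENNReal.tendsto_ofReal (hVlim.div_const (δ ^ 2))
    rwa [zero_div, ENNReal.ofReal_zero] at this
  exact tendsto_of_tendsto_of_tendsto_of_le_of_le tendsto_const_nhds hlim (fun _ => zero_le) hbound

/-- For a CONSTANT activity the pinned density `rhoLim` is a constant function (`β` is constant). -/
theorem rhoLim_const {a : ℝ} (ha : 0 < a) (σ : ℝ) (x y : T3) :
    rhoLim (profileOf (fun _ : T3 => a) continuous_const (fun _ => ha)) σ x =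
      rhoLim (profileOf (fun _ : T3 => a) continuous_const (fun _ => ha)) σ y := by
  simp only [rhoLim, profileOf_β]

/-- Flow families exist at every reduced density `0 < σ < 1/2` (Alexander's theorem on `𝕋³`). -/
theorem flows_nonempty {σ : ℝ} (hσ : 0 < σ) (hσ2 : σ < 1 / 2) : Nonempty ((N : ℕ) → Flow σ N) :=
  ⟨fun N => Classical.choice (HardSphereFlow.nonempty_torus_holds (d := Fin 3)
    (hsDiameter_pos hσ N) ((hsDiameter_le hσ.le N).trans_lt (hσ2.trans_eq (by norm_num)))
    (N + 1))⟩

/-- **The constant-profile LLN has a constant density**: `ConstantProfileLLN` holds. -/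
theorem constantProfileLLN_holds : ConstantProfileLLN := by
  intro a θ u ha hθ
  obtain ⟨σa, hσa, Ha⟩ := localGibbs_lln_holds (fun _ => a) (fun _ => θ) (fun _ => u)
    continuous_const continuous_const continuous_const (fun _ => ha) (fun _ => hθ)
  obtain ⟨σb, hσb, Hb⟩ := densityLLN_rhoLim (a₀ := fun _ : T3 => a) continuous_const (fun _ => ha)
  refine ⟨min (min σa σb) (1 / 2), lt_min (lt_min hσa hσb) (by norm_num), fun σ hσ hσlt => ?_⟩
  have hσa' : σ < σa := lt_of_lt_of_le hσlt ((min_le_left _ _).trans (min_le_left _ _))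
  have hσb' : σ < σb := lt_of_lt_of_le hσlt ((min_le_left _ _).trans (min_le_right _ _))
  have hσ2 : σ < 1 / 2 := lt_of_lt_of_le hσlt (min_le_right _ _)
  set P := profileOf (fun _ : T3 => a) continuous_const (fun _ => ha) with hP
  obtain ⟨h, hpos, hdens⟩ := Hb σ hσ hσb'
  obtain ⟨ρ₀, hρc, -, Hlln⟩ := Ha σ hσ hσa'
  set r : ℝ := rhoLim P σ 0 with hr
  have hrpos : 0 < r := h.rhoLim_pos (hpos 0)
  have hconst : rhoLim P σ = fun _ => r := funext fun x => rhoLim_const ha σ x 0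
  -- identify `ρ₀` with `rhoLim P σ` through the density component of the LLN along SOME flow
  obtain ⟨Φ⟩ := flows_nonempty hσ hσ2
  have hid : ρ₀ = rhoLim P σ := by
    refine eq_of_forall_integral_mul_eq hρc h.continuous_rhoLim fun χ hχ => ?_
    refine eq_of_tendsto_measure_lt_abs
      (P := fun N => localGibbsMeasure σ (fun _ : T3 => a) (fun _ => u) (fun _ => θ) N)
      (F := fun N z => empiricalDensityField z χ)
      (Eventually.of_forall fun N => isProbabilityMeasure_localGibbsMeasure continuous_const
        continuous_const continuous_const (fun _ => ha) (fun _ => hθ) hσ2.le N)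
      (fun δ hδ => ?_) (fun δ hδ => ?_)
    · -- the LLN of `localGibbs_lln_holds`, moved off the flow by `Φ_0 = id` a.e.
      have h1 := ((Hlln Φ).2 χ hχ δ hδ).1
      refine h1.congr fun N => ?_
      exact localGibbsLaw_preimage_flow_zero σ _ _ _ N (Φ N)
        {z | δ < |empiricalDensityField z χ - ∫ x, χ x * ρ₀ x|}
    · refine (tendsto_localGibbsMeasure_densityEvent (u₀ := fun _ => u) (θ₀ := fun _ => θ)
        continuous_const continuous_const continuous_const (fun _ => ha.le) (fun _ => hθ) σ hdens
        hχ hδ).congr fun N => ?_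
      simp only [empiricalDensityField_eq_sum]
  refine ⟨r, hrpos, fun Ψ => ?_⟩
  have hT := (Hlln Ψ).2
  rw [hid, hconst] at hT
  exact hT

end ConstantLLN

/-- **The reduction is unconditional**: the crux implies the equilibrium rung. -/
theorem equilibriumCollisionActivityTails_of_crux'
    (h : Summit.AtomisticToContinuum.HydrodynamicLimit.Theses.TwoClocks.CollisionActivityTails) :
    EquilibriumCollisionActivityTails :=
  equilibriumCollisionActivityTails_of_crux constantProfileLLN_holds h

/-- Contrapositive: **any counterexample to the equilibrium rung refutes the crux.** -/
theorem not_collisionActivityTails_of_not_equilibrium (h : ¬ EquilibriumCollisionActivityTails) :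
    ¬ Summit.AtomisticToContinuum.HydrodynamicLimit.Theses.TwoClocks.CollisionActivityTails :=
  fun hc => h (equilibriumCollisionActivityTails_of_crux' hc)

/-! ## §6 Targets — line `SketchK1` (lead prover-line-stmt-AtomisticToContinuum-13734-c1-0)

Read at 2026-08-16T10:45Z: `Lines/SketchK1.lean` (950 lines, 2 sorries = the two open stubs),
`Lines/SketchK1.md`, `PICKED.md`; landed Theorems files `OneFlightGossipEngineCollisionActivityTails*`.

JOINT SUFFICIENCY: formal — `CollisionActivityTails_of` is kernel-checked from the six stubs, the only
`sorry`s being `stub_nearFieldKineticTails` and `stub_crowdedCollisionTails`; the composition asks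
the three branches at levels `V/3, V/(3C), V/(3C)` and accuracies `ε/9, ε/(9C), ε/(9C)` — it
consumes the two open stubs IN CRUX SHAPE (V before ε), consistently with §3: nothing is smuggled,
and nothing weaker than crux-shaped tails of `F²`, `Fcr` would do (the Gronwall-free composition
inherits the shape).

STUB AUDIT (no kill; both open stubs are crux-KIND — same frame, same quantifier shape, same
physical content split into a kinetic half and a configurational half):
* `NearFieldKineticTails` (`F²_i = w⁻¹∫ Σ_{j≠i, d(x_j,x_i)≤2ε}|v_j−v_i|²`): Gibbs mean
  `≈ (32π/3)σ³·6θ₀·g ≈ 2·10²σ³θ₀ > 0` ⇒ `V₀` load-bearing (no-threshold variant paper-false, as §4);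
  all-windows variant paper-false (a single encounter of relative speed `g` lasting `≍ ε/g` puts
  `F² ≍ g·ε/w = gσ/τ`, above any `V` for `τ` small); junk audit benign (`intervalIntegral` of a
  bounded right-continuous function on the good set; junk `0` off it only shrinks the tail).
  The mobile-platoon scenario does NOT bite: co-moving clusters have SMALL relative kinetic energy.
  A fast tagged sphere of speed `u` has `F² ≍ 33σ³u²` only while it stays fast, i.e. for `O(1)`
  mean free times `= o(w)`: tail weight `→ 0` as `τ → ∞` at `t = 0` (Gaussian data) — consistent.
  Not refutable with present tools; TRUE at equilibrium iff a tagged-particle LLN in `τ` for the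
  co-moving `2ε`-ball relative kinetic occupation (renewal stream of `≍ 4πσ²ḡτ` visits).
* `CrowdedCollisionTails` (`Fcr_i`: impulses of collisions with both partners within `3ε` of `x_i`
  while `≥ 3` centres lie within `3ε`): Gibbs mean `O(σ³)·E[a] = O(σ⁶θ₀)`, tiny but positive
  (`V₀ > 0` needed formally only through the ∃); the dense-blob event gives `Fcr ≍ θ₀/δ′` on a
  fraction `α` at Gibbs cost `e^{-cαN}` — integrable pole, does not bite `L¹` (as §4b); small
  isolated clusters cannot sustain activity (Burago–Ferleger–Kononenko: finitely many collisions of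
  `n` balls in free space, each impulse `≤` relative speed by §2), so `Fcr > V` over `τ → ∞`
  windows needs clusters of size growing with `τ` ("mesoscopic condensation") — exactly the
  crux's open content; stub ⇏ crux and crux ⇏ stub in tail (isolated collisions invisible to
  `Fcr`; `Fcr` aggregates neighbours' activity, up to `7³` of them) — agreed with the lead's audit.
* The equilibrium reduction of §5b–§5c applies VERBATIM to both stubs (same frame): any
  equilibrium counterexample to either tail statement refutes that stub unconditionally.
No `stub_false` theorem is available; no `disprover-wanted` target was posted.

§6b below types the EQUILIBRIUM RUNGS of the two open stubs (vocabulary verbatim from the skeleton)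
and proves `stub → rung` unconditionally by the §5b–§5c specialisation: an equilibrium
counterexample to either rung kills that stub (and, for the lead: the rungs are the natural first
milestones of any proof of the stubs, though rung ⇏ stub). -/

/-! ### §6b Equilibrium rungs of the open stubs of line SketchK1 -/

section LineSketchK1

/-- Minimal-image distance of two points of `𝕋³` (skeleton vocabulary, verbatim). -/
def tdist (x y : T3) : ℝ := ‖(Torus.geometry (Fin 3)).sepVec x y‖

/-- Number of centres within distance `r` of the centre of particle `i`, itself included
(skeleton vocabulary, verbatim). -/
def nearCount {N : ℕ} (z : Cfg N) (i : Fin (N + 1)) (r : ℝ) : ℕ :=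
  (Finset.univ.filter fun j : Fin (N + 1) => tdist (z j).1 (z i).1 ≤ r).card

/-- Near-field relative kinetic energy at `i` (skeleton vocabulary, verbatim). -/
def relKineticNear {N : ℕ} (z : Cfg N) (i : Fin (N + 1)) (r : ℝ) : ℝ :=
  ∑ j : Fin (N + 1), if j ≠ i ∧ tdist (z j).1 (z i).1 ≤ r then ‖(z j).2 - (z i).2‖ ^ 2 else 0

/-- `F²_i`: the window-averaged near-field relative kinetic energy (skeleton vocabulary, verbatim). -/
def nearFieldKinetic {σ : ℝ} {N : ℕ} (Φ : Flow σ N) (τ s : ℝ) (i : Fin (N + 1)) (z : Cfg N) : ℝ :=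
  (window τ N)⁻¹ * ∫ t in s..(s + window τ N), relKineticNear (Φ.flow t z) i (2 * hsDiameter σ N)

/-- `Fcr_i`: the crowded collisional activity (skeleton vocabulary, verbatim). -/
def crowdedActivity {σ : ℝ} {N : ℕ} (Φ : Flow σ N) (τ s : ℝ) (i : Fin (N + 1)) (z : Cfg N) : ℝ :=
  σ / τ * Φ.collisionPairSum (Set.Ioc s (s + window τ N))
    (fun t y k l =>
      if tdist (y k).1 (y i).1 ≤ 3 * hsDiameter σ N ∧ tdist (y l).1 (y i).1 ≤ 3 * hsDiameter σ N ∧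
          3 ≤ nearCount y i (3 * hsDiameter σ N) then
        ‖(HardSphereCollisionRecord.ofConfig (Torus.geometry (Fin 3)) (hsDiameter σ N) y t k l).postVel.1 -
          (HardSphereCollisionRecord.ofConfig (Torus.geometry (Fin 3)) (hsDiameter σ N) y t k l).preVel.1‖
      else 0) z

/-- A crux-shaped tail statement for a particle functional `F` (the common frame of the crux and
of the two open stubs): `TailStatement F` with `F = activity-like functional of (Φ N, τ, s, i, z)`. -/
def TailStatement (F : ∀ {σ : ℝ} {N : ℕ}, Flow σ N → ℝ → ℝ → Fin (N + 1) → Cfg N → ℝ) : Prop :=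
  ∀ (a₀ θ₀ : T3 → ℝ) (u₀ : T3 → V3), Continuous a₀ → Continuous θ₀ → Continuous u₀ →
    (∀ x, 0 < a₀ x) → (∀ x, 0 < θ₀ x) → ∃ σ₀ : ℝ, 0 < σ₀ ∧ ∀ σ : ℝ, 0 < σ → σ < σ₀ →
    ∀ (T : ℝ) (ρ θ : ℝ → T3 → ℝ) (u : ℝ → T3 → V3), IsHardSphereEulerSolution σ T ρ u θ →
    ∀ Φ : (N : ℕ) → Flow σ N,
    TendstoHydroFieldsAt (fun N => localGibbsLaw σ a₀ u₀ θ₀ N (Φ N)) Φ ρ u θ 0 →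
    ∀ t ∈ Set.Ico 0 T, ∃ V₀ : ℝ, 0 < V₀ ∧ ∀ V : ℝ, V₀ ≤ V → ∀ ε : ℝ, 0 < ε →
    ∃ τ₀ : ℝ, 0 < τ₀ ∧ ∀ τ : ℝ, τ₀ ≤ τ → ∃ N₀ : ℕ, ∀ N : ℕ, N₀ ≤ N → ∀ s ∈ Set.Icc 0 t,
      ∫⁻ z, ENNReal.ofReal (((N : ℝ) + 1)⁻¹ * ∑ i : Fin (N + 1), tailFn V (F (Φ N) τ s i z))
        ∂(localGibbsLaw σ a₀ u₀ θ₀ N (Φ N)) ≤ ENNReal.ofReal ε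

/-- The equilibrium rung of a crux-shaped tail statement (constant profiles, `s = 0`). -/
def EquilibriumTailStatement
    (F : ∀ {σ : ℝ} {N : ℕ}, Flow σ N → ℝ → ℝ → Fin (N + 1) → Cfg N → ℝ) : Prop :=
  ∀ (a₀ θ₀ : ℝ) (u₀ : V3), 0 < a₀ → 0 < θ₀ → ∃ σ₀ : ℝ, 0 < σ₀ ∧ ∀ σ : ℝ, 0 < σ → σ < σ₀ →
    ∀ Φ : (N : ℕ) → Flow σ N, ∃ V₀ : ℝ, 0 < V₀ ∧ ∀ V : ℝ, V₀ ≤ V → ∀ ε : ℝ, 0 < ε →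
    ∃ τ₀ : ℝ, 0 < τ₀ ∧ ∀ τ : ℝ, τ₀ ≤ τ → ∃ N₀ : ℕ, ∀ N : ℕ, N₀ ≤ N →
      ∫⁻ z, ENNReal.ofReal (((N : ℝ) + 1)⁻¹ * ∑ i : Fin (N + 1), tailFn V (F (Φ N) τ 0 i z))
        ∂(localGibbsLaw σ (fun _ => a₀) (fun _ => u₀) (fun _ => θ₀) N (Φ N)) ≤ ENNReal.ofReal ε

/-- **Every crux-shaped tail statement implies its equilibrium rung** (constant states +
`constantProfileLLN_holds`, as in §5b–§5c). -/
theorem equilibriumTailStatement_of_tailStatement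
    {F : ∀ {σ : ℝ} {N : ℕ}, Flow σ N → ℝ → ℝ → Fin (N + 1) → Cfg N → ℝ} (h : TailStatement F) :
    EquilibriumTailStatement F := by
  intro a₀ θ₀ u₀ ha hθ
  obtain ⟨σc, hσc, hc⟩ := h (fun _ => a₀) (fun _ => θ₀) (fun _ => u₀) continuous_const
    continuous_const continuous_const (fun _ => ha) (fun _ => hθ)
  obtain ⟨σ₁, hσ₁, hl⟩ := constantProfileLLN_holds a₀ θ₀ u₀ ha hθ
  refine ⟨min σc σ₁, lt_min hσc hσ₁, fun σ hσ hσlt Φ => ?_⟩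
  have hσc' : σ < σc := hσlt.trans_le (min_le_left _ _)
  have hσ₁' : σ < σ₁ := hσlt.trans_le (min_le_right _ _)
  obtain ⟨r, hr, hlln⟩ := hl σ hσ hσ₁'
  obtain ⟨V₀, hV₀, H⟩ := hc σ hσ hσc' 1 (fun _ _ => r) (fun _ _ => θ₀) (fun _ _ => u₀)
    (isHardSphereEulerSolution_const σ 1 u₀ hr hθ) Φ (hlln Φ) 0 ⟨le_rfl, one_pos⟩
  refine ⟨V₀, hV₀, fun V hV ε hε => ?_⟩
  obtain ⟨τ₀, hτ₀, H⟩ := H V hV ε hε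
  refine ⟨τ₀, hτ₀, fun τ hτ => ?_⟩
  obtain ⟨N₀, H⟩ := H τ hτ
  exact ⟨N₀, fun N hN => H N hN 0 ⟨le_rfl, le_rfl⟩⟩

/-- The line's stub 5, `NearFieldKineticTails`, is the tail statement of `F²` (verbatim up to the
name `tailFn`). -/
def NearFieldKineticTails : Prop := TailStatement (fun Φ τ s i z => nearFieldKinetic Φ τ s i z)

/-- The line's stub 6, `CrowdedCollisionTails`, is the tail statement of `Fcr`. -/
def CrowdedCollisionTails : Prop := TailStatement (fun Φ τ s i z => crowdedActivity Φ τ s i z)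

/-- **Equilibrium rung of stub 5**: any equilibrium counterexample to the `F²` tail kills stub 5. -/
theorem equilibrium_of_nearFieldKineticTails (h : NearFieldKineticTails) :
    EquilibriumTailStatement (fun Φ τ s i z => nearFieldKinetic Φ τ s i z) :=
  equilibriumTailStatement_of_tailStatement h

/-- **Equilibrium rung of stub 6**: any equilibrium counterexample to the `Fcr` tail kills stub 6. -/
theorem equilibrium_of_crowdedCollisionTails (h : CrowdedCollisionTails) :
    EquilibriumTailStatement (fun Φ τ s i z => crowdedActivity Φ τ s i z) :=
  equilibriumTailStatement_of_tailStatement h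

/-- The crux itself is the tail statement of the activity (definitionally), so §5's reduction is
the instance `F = activity` of `equilibriumTailStatement_of_tailStatement`. -/
theorem collisionActivityTails_iff_tailStatement :
    Summit.AtomisticToContinuum.HydrodynamicLimit.Theses.TwoClocks.CollisionActivityTails ↔
      TailStatement (fun {_ N} Φ τ s i z => activity Φ τ (Set.Ioc s (s + window τ N)) i z) :=
  Iff.rfl

end LineSketchK1


/-! ## §7 Cycle 2 (gen 2, 2026-08-16T13:30Z–): the UI ⊓ fraction split, line audit, new regimes

### §7a The crux shape is EXACTLY "UI shape ∧ crux-shaped FRACTION statement"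

Line `SketchK1` (lead c1-0, skeleton 08b15774, 12:20Z) re-split its two open stubs:
`NearFieldKineticTails ⇐ KineticEnergyTails ∧ NearFieldFractionLLN` (through the landed
`NearFieldStatics` p102147 / `NearFieldPathwise` p105299: packing truncation
`Σᵢ𝟙{V<F²ᵢ}F²ᵢ ≤ 2000·w⁻¹∫ kinTailAvg M + 1000M²·Σᵢ𝟙{V<F²ᵢ}`), and
`CrowdedCollisionTails ⇐ CrowdedActivityUI ∧ CrowdedFractionLLN`.  In the abstract (law
functionals on `ℝ`, which is all the tail functional sees) this split is an EQUIVALENCE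
(`cruxShape_iff_uiShape_and_fracShape`): `V·P(a>V) ≤ E[𝟙{V<a}a]` gives crux ⇒ fraction, and the
truncation `𝟙{V<y}y ≤ 𝟙{K<y}y + K𝟙{V<y}` gives UI ∧ fraction ⇒ crux.  Both halves are
load-bearing and SEPARATED by §3's families: the spike family satisfies the fraction statement
(`fracShape_spikeLaw`, `P(a>V) = (N+1)⁻¹`) with mean `1` and fails UI; the geometric law is UI with
all moments and fails the fraction statement (`not_fracShape_geomLaw`).  CONSEQUENCES.
(i) `CrowdedActivityUI ∧ CrowdedFractionLLN` is a REFORMULATION of `CrowdedCollisionTails`, not a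
weakening: the LLN content sits in the fraction half, the no-escape-of-mass content in the UI half;
neither is implied by the crux (the only crux ↔ `Fcr` link in the line is the MEAN domination
`Σᵢ Fcrᵢ ≤ 343 Σₖ aₖ`, and mean information is blind to UI: spike family).  (ii) The near-field
split is NOT a reformulation: it trades the UI half of `F²` for VELOCITY UI along the flow
(`JParityClosure.KineticEnergyTails`, stmt-13087, an open a-priori estimate shared with other
routes — the "fixed-density wall" in its kinetic form) plus deterministic packing; the line now
leans on 13087.  Landed: `Negative/ShapeSeparation.lean` (p106653, review) — shapes, equivalence,
crux-is-crux-shaped; witnesses to follow in `Negative/ShapeWitnesses.lean`. -/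

/-- The fraction functional `μ{V < y}` of a law `μ` on `ℝ` (as an integral of an indicator). -/
def lawFrac (μ : Measure ℝ) (V : ℝ) : ℝ≥0∞ :=
  ∫⁻ y, Set.indicator {y : ℝ | V < y} (fun _ => (1 : ℝ≥0∞)) y ∂μ

/-- The fraction functional is the measure of the super-level set. -/
theorem lawFrac_eq (μ : Measure ℝ) (V : ℝ) : lawFrac μ V = μ {y : ℝ | V < y} :=
  lintegral_indicator_one (measurableSet_lt measurable_const measurable_id)

/-- The tail functional is antitone in the threshold, in `ℝ≥0∞` (any thresholds). -/
theorem ofReal_tailFn_anti {K K' : ℝ} (hKK' : K ≤ K') (y : ℝ) :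
    ENNReal.ofReal (tailFn K' y) ≤ ENNReal.ofReal (tailFn K y) := by
  by_cases h : K' < y
  · rw [tailFn_of_lt h, tailFn_of_lt (hKK'.trans_lt h)]
  · rw [tailFn_of_le (not_lt.1 h), ENNReal.ofReal_zero]
    exact bot_le

/-- The law tail is antitone in the threshold. -/
theorem lawTail_anti (μ : Measure ℝ) {K K' : ℝ} (hKK' : K ≤ K') : lawTail μ K' ≤ lawTail μ K :=
  lintegral_mono fun y => ofReal_tailFn_anti hKK' y

/-- **Chebyshev at the threshold**: `V · μ{V < y} ≤ E_μ[𝟙{V < y} y]`. -/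
theorem ofReal_mul_lawFrac_le (μ : Measure ℝ) (V : ℝ) :
    ENNReal.ofReal V * lawFrac μ V ≤ lawTail μ V := by
  rw [lawFrac, ← lintegral_const_mul' _ _ ENNReal.ofReal_ne_top]
  refine lintegral_mono fun y => ?_
  by_cases h : V < y
  · rw [Set.indicator_of_mem (show y ∈ {y : ℝ | V < y} from h), mul_one, tailFn_of_lt h]
    exact ENNReal.ofReal_le_ofReal h.le
  · rw [Set.indicator_of_notMem (show y ∉ {y : ℝ | V < y} from h), mul_zero]
    exact bot_le

/-- **Truncation**: `E_μ[𝟙{V < y} y] ≤ E_μ[𝟙{K < y} y] + K⁺ · μ{V < y}` (any `K`). -/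
theorem lawTail_le_add (μ : Measure ℝ) (V K : ℝ) :
    lawTail μ V ≤ lawTail μ K + ENNReal.ofReal K * lawFrac μ V := by
  rw [lawTail, lawTail, lawFrac, ← lintegral_const_mul' _ _ ENNReal.ofReal_ne_top,
    ← lintegral_add_left ((measurable_tailFn K).ennreal_ofReal)]
  refine lintegral_mono fun y => ?_
  by_cases hV : V < y
  · rw [tailFn_of_lt hV, Set.indicator_of_mem (show y ∈ {y : ℝ | V < y} from hV), mul_one]
    by_cases hKy : K < y
    · rw [tailFn_of_lt hKy]
      exact le_self_add
    · rw [tailFn_of_le (not_lt.1 hKy), ENNReal.ofReal_zero, zero_add]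
      exact ENNReal.ofReal_le_ofReal (not_lt.1 hKy)
  · rw [tailFn_of_le (not_lt.1 hV), ENNReal.ofReal_zero]
    exact bot_le

/-- The crux shape implies the crux-shaped FRACTION statement `P(a > V) → 0` (`V ≥ V₀`). -/
theorem CruxShape.fracShape {ν : ℝ → ℕ → Measure ℝ}
    (h : CruxShape fun V τ N => lawTail (ν τ N) V) : CruxShape fun V τ N => lawFrac (ν τ N) V := by
  obtain ⟨V₀, hV₀, h⟩ := h
  refine ⟨V₀, hV₀, fun V hV ε hε => ?_⟩
  have hVpos : 0 < V := hV₀.trans_le hV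
  obtain ⟨τ₀, hτ₀, h⟩ := h V hV (V * ε) (mul_pos hVpos hε)
  refine ⟨τ₀, hτ₀, fun τ hτ => ?_⟩
  obtain ⟨N₀, h⟩ := h τ hτ
  refine ⟨N₀, fun N hN => ?_⟩
  have key : ENNReal.ofReal V * lawFrac (ν τ N) V ≤ ENNReal.ofReal V * ENNReal.ofReal ε := by
    rw [← ENNReal.ofReal_mul hVpos.le]
    exact (ofReal_mul_lawFrac_le _ V).trans (h N hN)
  exact (ENNReal.mul_le_mul_iff_right (ENNReal.ofReal_pos.2 hVpos).ne' ENNReal.ofReal_ne_top).1 key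

/-- **UI shape ∧ fraction statement ⇒ crux shape** (the cycle-2 split of line `SketchK1` in the
abstract): truncate at the UI level `K`, then kill `K · P(a > V)` with the fraction statement. -/
theorem cruxShape_of_uiShape_of_fracShape {ν : ℝ → ℕ → Measure ℝ}
    (hUI : UIShape fun V τ N => lawTail (ν τ N) V)
    (hF : CruxShape fun V τ N => lawFrac (ν τ N) V) :
    CruxShape fun V τ N => lawTail (ν τ N) V := by
  obtain ⟨V₀, hV₀, hF⟩ := hF
  refine ⟨V₀, hV₀, fun V hV ε hε => ?_⟩
  obtain ⟨K, τa, hτa, hK⟩ := hUI (ε / 2) (half_pos hε)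
  set K' : ℝ := max K 1 with hK'
  have hK'pos : 0 < K' := lt_of_lt_of_le one_pos (le_max_right _ _)
  obtain ⟨τb, hτb, hb⟩ := hF V hV (ε / 2 / K') (div_pos (half_pos hε) hK'pos)
  refine ⟨max τa τb, lt_max_of_lt_left hτa, fun τ hτ => ?_⟩
  obtain ⟨Na, hNa⟩ := hK τ ((le_max_left _ _).trans hτ)
  obtain ⟨Nb, hNb⟩ := hb τ ((le_max_right _ _).trans hτ)
  refine ⟨max Na Nb, fun N hN => ?_⟩
  have h1 : lawTail (ν τ N) K' ≤ ENNReal.ofReal (ε / 2) :=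
    (lawTail_anti _ (le_max_left K 1)).trans (hNa N ((le_max_left _ _).trans hN))
  have h2 : lawFrac (ν τ N) V ≤ ENNReal.ofReal (ε / 2 / K') := hNb N ((le_max_right _ _).trans hN)
  calc lawTail (ν τ N) V ≤ lawTail (ν τ N) K' + ENNReal.ofReal K' * lawFrac (ν τ N) V :=
        lawTail_le_add _ V K'
    _ ≤ ENNReal.ofReal (ε / 2) + ENNReal.ofReal K' * ENNReal.ofReal (ε / 2 / K') :=
        add_le_add h1 (mul_le_mul_right h2 _)
    _ = ENNReal.ofReal ε := by
        rw [← ENNReal.ofReal_mul hK'pos.le, mul_div_cancel₀ _ hK'pos.ne',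
          ← ENNReal.ofReal_add (half_pos hε).le (half_pos hε).le, add_halves]

/-- **The crux shape is exactly UI shape ∧ crux-shaped fraction statement** (law functionals). -/
theorem cruxShape_iff_uiShape_and_fracShape (ν : ℝ → ℕ → Measure ℝ) :
    CruxShape (fun V τ N => lawTail (ν τ N) V) ↔
      UIShape (fun V τ N => lawTail (ν τ N) V) ∧ CruxShape fun V τ N => lawFrac (ν τ N) V :=
  ⟨fun h => ⟨h.uiShape, h.fracShape⟩, fun h => cruxShape_of_uiShape_of_fracShape h.1 h.2⟩

/-- The hyperactive fraction of the spike family above any threshold `V ≥ 0` is at most `(N+1)⁻¹`. -/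
theorem lawFrac_spikeLaw_le (N : ℕ) {V : ℝ} (hV : 0 ≤ V) :
    lawFrac (spikeLaw N) V ≤ ENNReal.ofReal (((N : ℝ) + 1)⁻¹) := by
  rw [lawFrac, lintegral_spikeLaw,
    Set.indicator_of_notMem (show (0 : ℝ) ∉ {y : ℝ | V < y} from fun h => (not_lt.2 hV) h),
    mul_zero, zero_add]
  calc ENNReal.ofReal (((N : ℝ) + 1)⁻¹) * Set.indicator {y : ℝ | V < y} (fun _ => (1 : ℝ≥0∞)) ((N : ℝ) + 1)
      ≤ ENNReal.ofReal (((N : ℝ) + 1)⁻¹) * 1 :=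
        mul_le_mul_right (Set.indicator_le_self' (fun _ _ => zero_le_one) _) _
    _ = _ := mul_one _

/-- **The spike family satisfies the crux-shaped FRACTION statement** (`P(a > V) = (N+1)⁻¹ → 0`):
so the vanishing of the hyperactive fraction (the `…FractionLLN` half of the cycle-2 split), even
with a bounded mean, does not give the tail statement — the UI half is load-bearing. -/
theorem fracShape_spikeLaw : CruxShape fun V (_ : ℝ) N => lawFrac (spikeLaw N) V := by
  refine ⟨1, one_pos, fun V hV ε hε => ⟨1, one_pos, fun τ _ => ⟨⌈ε⁻¹⌉₊, fun N hN => ?_⟩⟩⟩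
  refine (lawFrac_spikeLaw_le N (zero_le_one.trans hV)).trans (ENNReal.ofReal_le_ofReal ?_)
  have h1 : ε⁻¹ ≤ (N : ℝ) + 1 := by
    have : (⌈ε⁻¹⌉₊ : ℝ) ≤ N := by exact_mod_cast hN
    linarith [Nat.le_ceil ε⁻¹]
  calc ((N : ℝ) + 1)⁻¹ ≤ (ε⁻¹)⁻¹ := by
        exact inv_anti₀ (inv_pos.2 hε) h1
    _ = ε := inv_inv ε

/-- **The hyperactive fraction of the geometric law never dies**: above every threshold `V` it is
at least `2^{-(⌈V⌉₊+1)}`. -/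
theorem geomWeight_le_lawFrac_geomLaw (V : ℝ) :
    ENNReal.ofReal (geomWeight ⌈V⌉₊) ≤ lawFrac geomLaw V := by
  rw [lawFrac, lintegral_geomLaw]
  refine le_trans ?_ (ENNReal.le_tsum ⌈V⌉₊)
  have hlt : V < (⌈V⌉₊ : ℝ) + 1 := by linarith [Nat.le_ceil V]
  rw [Set.indicator_of_mem (show (⌈V⌉₊ : ℝ) + 1 ∈ {y : ℝ | V < y} from hlt), mul_one]

/-- **The crux-shaped fraction statement fails for the geometric law** (UI, all moments finite):
so uniform integrability (the `…UI` half of the cycle-2 split, or velocity UI `KineticEnergyTails`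
plus packing for the near-field term) does not give the tail statement — the fraction half (the law
of large numbers in `τ`) is load-bearing. -/
theorem not_fracShape_geomLaw : ¬ CruxShape (fun V _ _ => lawFrac geomLaw V) := by
  rintro ⟨V₀, -, h⟩
  set c : ℝ := geomWeight ⌈V₀⌉₊
  have hc0 : 0 < c := geomWeight_pos _
  obtain ⟨τ₀, -, h⟩ := h V₀ le_rfl (c / 2) (half_pos hc0)
  obtain ⟨N₀, hN⟩ := h τ₀ le_rfl
  have key := hN N₀ le_rfl
  simp only at key
  have hlow := geomWeight_le_lawFrac_geomLaw V₀
  have : ENNReal.ofReal c ≤ ENNReal.ofReal (c / 2) := hlow.trans key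
  have := (ENNReal.ofReal_le_ofReal_iff (half_pos hc0).le).1 this
  linarith

/-! ### §7b Line `SketchK1` after the lead's cycle-2 reshape (skeleton 08b15774, 2026-08-16T12:20Z)

Registered stubs: `stub_kineticEnergyTails : KineticEnergyTails` (= the external open item
stmt-13087 of route JParityClosure, velocity UI along the flow), `stub_nearFieldFractionLLN`,
`stub_nearFieldReduction : KineticEnergyTails → NearFieldFractionLLN → NearFieldKineticTails`,
`stub_nearFieldStatics` (LANDED p102147, deterministic packing), `stub_nearFieldPathwise` (LANDED
p105299, deterministic), `stub_crowdedActivityUI`, `stub_crowdedFractionLLN`.  The bodies of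
`NearFieldFractionLLN`, `CrowdedActivityUI`, `CrowdedFractionLLN` are not yet published to
`Lines/SketchK1.lean` (tree copy is the 10:52Z skeleton); audited on their natural readings:

* FRACTION stubs (`…FractionLLN`: `∃V₀ ∀V≥V₀ ∀ε ∃τ₀ ∀τ≥τ₀ ∃N₀ ∀N≥N₀ ∀s≤t:
  E[(N+1)⁻¹Σᵢ 𝟙{V < Fᵢ}] ≤ ε`, `F = F²` resp. `Fcr`): crux-KIND (same frame, same shape;
  `TailStatement (fracFn ∘ F)` up to the name of the scalar functional); `V₀` load-bearing (`V₀`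
  below the equilibrium mean `m_F` makes the fraction tend to ONE by the very LLN the stub asserts:
  `m_{F²} ≈ (32π/3)σ³g·6θ₀`, `m_{Fcr} = O(σ⁶θ₀)` for `36πσ³g ≪ 1` — but `≈ 10·E a` at `σ³ = 0.1`, where the `3ε`-ball holds `≈ 36πσ³g ≈ 13` centres and is ALWAYS crowded, lead's MD); `τ → ∞` load-bearing (short windows: the
  fraction is `P(≥ 1 event in window) ↛ 0` uniformly); equilibrium rung by §6b verbatim
  (`equilibriumTailStatement_of_tailStatement` is generic in the scalar functional).  No kill;
  these ARE the laws of large numbers in `τ` (kinetic: co-moving `2ε`-ball occupation by fast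
  relative motion; configurational: crowded-collision impulse near the tagged sphere).
* `CrowdedActivityUI`: if stated in UI SHAPE (`∀ε ∃K ∃τ₀ ∀τ≥τ₀ ∃N₀ ∀N ∀s`), it is implied by
  `CrowdedCollisionTails` (`CruxShape.uiShape`) and, with `CrowdedFractionLLN`, equivalent to it
  (§7a): a reformulation.  CAVEAT (would be a stub-misstatement): if stated UNIFORMLY OVER ALL
  WINDOWS (`∀ τ > 0`, or `K, N₀` chosen before `τ` ranges down to `0`), it is PAPER-FALSE at
  equilibrium exactly like `CollisionActivityTailsAllWindows` (§4): `E[Fcr] = m_{Fcr} > 0` does not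
  depend on `τ` (stationarity: `Fcr` is a window AVERAGE, `σ/τ = ε/w`), while `Fcr → 0` in
  probability as `τ → 0` (no crowded collision in a sub-mean-free-time window), so the mass
  `m_{Fcr}` escapes to infinity and `sup_{τ ≤ 1} E[Fcr 𝟙{Fcr > K}] = m_{Fcr}` for every `K`
  (Vitali).  Tiny (`O(σ⁶θ₀)`) but formally fatal since `ε` is arbitrary.  To be checked against the
  published body; posted to the lead as a note.
* `KineticEnergyTails` (13087): open, physically true (local Maxwellians), has its own lattice of
  reductions (`JParityClosureKineticEnergyTails.lean`: implied by `EnergyCurrentTails` 9235, by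
  `ExpVelocityMomentBound` 11518, by the barrier hypothesis `HighMomentumCutoff`); the line now
  imports the kinetic "fixed-density wall" explicitly instead of hiding it in `NearFieldKineticTails`.
  Not attackable here (it is not a consequence of the crux nor conversely).
* The LEAD'S QUESTION (line card 11:12Z, "disprover-wanted: is `CrowdedCollisionTails` false while
  the crux holds — visitor part not crux-implied?"): no formal separation is possible (both are
  parameter-free statements about the same dynamics; exhibiting `crux ∧ ¬stub` means deciding
  both).  What IS checkable: the only crux → `Fcr` transfer in the line is mean domination, which
  cannot give UI (`exists_meanBounded_not_uiShape`), let alone tails; and at equilibrium both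
  statements are tagged-particle window LLNs of the same kind — `Fcr` is an additive functional of
  the VISITOR stream of the tagged sphere (renewal-type, `≍ σ²τ′` visits per window, each
  contributing a bounded-mean impulse while the `3ε`-neighbourhood is crowded), with no mechanism
  for persistent crowding at `σ < σ₀` small (no cages below freezing; droplets evaporate at thermal
  speed).  Verdict: no evidence that `CrowdedCollisionTails` is false; it is HARDER than the crux
  only in bookkeeping (up to `7³` neighbours aggregated), not in kind.

### §7c New regimes tried on the crux itself (cycle 2) — no kill

* GLOBAL-IN-TIME EULER DATA.  The hypothesis `IsHardSphereEulerSolution σ T ρ u θ` admits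
  `T` arbitrarily large for shock-free classical solutions: besides constant states (§5), every
  STEADY SHEAR FLOW `(ρ₀, f(x₂)e₁, θ₀)` (`f` smooth periodic) is a global classical solution
  (`u·∇u = 0`, `div u = 0`, `∇p = 0`), and its `t = 0` LLN is dischargeable (`a₀, θ₀` constant ⇒
  constant density, §5c).  So the crux asserts activity tails at EVERY `t ≥ 0` for the true dynamics
  from sheared local Gibbs data — beyond any "pre-shock" intuition.  Not a kill: `t` is fixed
  BEFORE `N → ∞`, and on a fixed macroscopic time the microscopic viscosity
  `ν ≍ λ_mfp √θ ≍ (N+1)^{-1/3}√θ₀/σ² → 0` produces neither viscous heating (`O(νt)`) nor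
  amplification of thermal fluctuations by the Kelvin–Helmholtz instability
  (`N^{-1/2} e^{γt} → 0`); locally the law stays Maxwellian with bounded `(ρ, u, θ)`, activity level
  `4πρσ³θ g`.  (A typed "shear rung" `crux → ShearCollisionActivityTails` would need the torus
  calculus of `IsHardSphereEulerSolutionDim` for `x₂`-dependent fields; recorded, not built — it
  carries no counterexample.)
* FAST-PARTICLE ROUTE TO HYPERACTIVITY.  A sphere of speed `u ≫ √θ` has collision rate
  `≍ πε²n u` and impulse `≍ u` per collision, so WHILE FAST its activity is `aᵢ ≍ cπσ³u²`
  (`ε(N+1)^{1/3} = σ`): activity above `V` needs `u² ≳ V/σ³` sustained over the whole window,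
  i.e. over `≍ σ²τ′u/√θ → ∞` collisions, against equal-mass thermalisation in `O(1)` collisions.
  Under local Gibbs data the fast fraction is Gaussian-small and not replenished (no energy
  cascade to few particles pre-shock); this is the kinetic half (`KineticEnergyTails`-type input)
  and gives no counterexample.
* INITIAL LAYER: none at leading order (local Maxwellians are the leading Hilbert term); the
  `s = 0` member of the family is the time-zero rung "local Gibbs data + dynamics over a vanishing
  macroscopic time `w`", equilibrium-like cell by cell.
* MUTATION `σ₀` (smallness of the reduced density): load-bearing for the HYPOTHESES' machinery
  (the tree's `t = 0` LLN / cluster expansion live at small `σ`), but apparently NOT for the truth of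
  the conclusion at equilibrium: at packing `φ = πσ³/6` up to coexistence (`σ → 1⁻`, `φ → π/6`, the
  simple-cubic touching limit of the torus scaling) a caged sphere rattles at rate `≍ √θ/gap` with
  impulses `≍ √θ`, activity `≍ εθ/gap = O(θ (φ_cp/φ)^{1/3}/((φ_cp/φ)^{1/3} − 1))` — LARGER but finite
  below close packing, and its collision stream is more regular, not less; `V₀` is existential.
  High density is not where a counterexample lives either (recorded for planners: the dilute guard
  is a tool restriction, not a truth restriction).
* ORDER OF LIMITS re-examined: `N₀` after `τ` (so `w = τ(N+1)^{-1/3} → 0` at fixed `τ`), `s`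
  uniform after `N₀`; the diagonal / swapped orders are different statements, none claimed.
* FORMAL RE-AUDIT of the summand and of `∀ Φ` (independent of cycle 1): `collisionSum` ranges
  over `collisionTimes ∩ (s, s+w]` and over the ordered pairs in CONTACT at each collision time
  (`contactPairs`: `i ≠ j ∧ ‖sepVec xᵢ xⱼ‖ = ε`); on GOOD orbits the trajectory axiom
  `IsHardSphereTrajectory.binary` forces exactly one pair in contact at a collision time, so these
  are the colliding pair in its two orders, and `c.fst = i` picks each collision of `i` once; the
  summand is the impulse READ OFF the configuration, `|⟨vᵢ − vⱼ, n⟩|/‖n‖` (§2).  The structure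
  `HardSphereFlow` pins the orbit of every good point to the genuine deterministic dynamics
  (`free` flight between locally finite collision times, `binary` elastic collisions from an
  incoming left limit), the good set is conull and `λ_N ≪` Liouville: NO junk flow can inflate the
  activity, `∀ Φ` is fictitious.  Off the good set / with infinitely many collision times the
  `finsum` junk is `0` ⇒ activity `0` (only lowers tails); the lower `∫⁻` of a possibly
  non-measurable integrand only lowers the left side.  Every junk convention makes the crux EASIER.

VERDICT after cycle 2: unchanged — OPEN, physically true, not refutable with present tools; the
statement is formally tight (no junk freedom), and its negation at `σ < σ₀(profiles)` would
contradict local equilibrium itself.  What provers need is exactly one thing, now isolated three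
times over (§3 shape, ExcessShape p99623, §7a split): a one-sided law of large numbers in the
window length for a tagged-sphere additive functional under the true pre-shock law, uniformly in
`N` — kinetic half = velocity UI along the flow (13087), configurational half = no mesoscopic
condensation. -/

/-! ### §7d Global-in-time data: the crux claims tails at EVERY `t ≥ 0` (typed corollary)

For data admitting a GLOBAL classical hs-Euler solution tied to the local Gibbs profiles by the
`t = 0` LLN — constant states (§5), steady shear flows `(ρ₀, f(x₂)e₁, θ₀)`, isobaric static
states `(ρ(x), 0, θ(x))` with `ρθZ(ρσ³) ≡ const` (no heat conduction in Euler), and shears along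
their isodensity surfaces — the horizon is `T = ∞` and the crux asserts the activity tails at every
fixed macroscopic time.  Harmless (the true gas conducts heat and momentum only at rate
`≍ λ_mfp √θ → 0` on fixed times as `N → ∞`), but worth stating: "pre-shock" is not a smallness
condition on `t`.  Remark on RATES (from the lead's equilibrium EDMD, jobs j016328/30/37, `σ³ = 0.1`,
`θ = 1`, 1728 spheres): `E[a𝟙{a > 2Ea}] = 0.30, 0.018, < 5·10⁻⁴` at `τ = 2, 8, 32` fits a
large-deviation rate LINEAR in `τ` (`e^{-cτ}`, `c ≈ 0.47`: Gaussian/CLT fluctuations of the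
collision count, variance `∝ 1/τ′`), not the droplet law `e^{-c(τ/σ)³}` of the route text — the
dominant tail mechanism at levels `V = O(m)` is ordinary fluctuation of a renewal-type count, the
caging/droplet mechanism is sub-dominant; immaterial for the crux (both vanish), informative for
provers (what must be controlled is the variance/mixing of the tagged collision stream, not rare
condensation). -/

/-- A GLOBAL classical hard-sphere-Euler solution (every horizon). -/
def IsGlobalHardSphereEulerSolution (σ : ℝ) (ρ θ : ℝ → T3 → ℝ) (u : ℝ → T3 → V3) : Prop :=
  ∀ T : ℝ, IsHardSphereEulerSolution σ T ρ u θ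

/-- Constant states are global solutions. -/
theorem isGlobalHardSphereEulerSolution_const (σ : ℝ) {ρ₀ θ₀ : ℝ} (u₀ : V3) (hρ : 0 < ρ₀)
    (hθ : 0 < θ₀) :
    IsGlobalHardSphereEulerSolution σ (fun _ _ => ρ₀) (fun _ _ => θ₀) (fun _ _ => u₀) :=
  fun T => isHardSphereEulerSolution_const σ T u₀ hρ hθ

/-- **Global-in-time corollary.**  Along data with a global classical solution tied by the `t = 0`
LLN, the crux yields the activity tails at EVERY `t ≥ 0` (take the horizon `T := t + 1`). -/
theorem collisionActivityTails_allTimes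
    (h : Summit.AtomisticToContinuum.HydrodynamicLimit.Theses.TwoClocks.CollisionActivityTails)
    (a₀ θ₀ : T3 → ℝ) (u₀ : T3 → V3) (ha : Continuous a₀) (hθ : Continuous θ₀) (hu : Continuous u₀)
    (ha0 : ∀ x, 0 < a₀ x) (hθ0 : ∀ x, 0 < θ₀ x) :
    ∃ σ₀ : ℝ, 0 < σ₀ ∧ ∀ σ : ℝ, 0 < σ → σ < σ₀ →
      ∀ (ρ θ : ℝ → T3 → ℝ) (u : ℝ → T3 → V3), IsGlobalHardSphereEulerSolution σ ρ θ u →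
      ∀ Φ : (N : ℕ) → Flow σ N,
      TendstoHydroFieldsAt (fun N => localGibbsLaw σ a₀ u₀ θ₀ N (Φ N)) Φ ρ u θ 0 →
      ∀ t : ℝ, 0 ≤ t → ∃ V₀ : ℝ, 0 < V₀ ∧ ∀ V : ℝ, V₀ ≤ V → ∀ ε : ℝ, 0 < ε →
      ∃ τ₀ : ℝ, 0 < τ₀ ∧ ∀ τ : ℝ, τ₀ ≤ τ → ∃ N₀ : ℕ, ∀ N : ℕ, N₀ ≤ N → ∀ s ∈ Set.Icc 0 t,
        ∫⁻ z, ENNReal.ofReal (activityTail N V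
            (fun i => activity (Φ N) τ (Set.Ioc s (s + window τ N)) i z))
          ∂(localGibbsLaw σ a₀ u₀ θ₀ N (Φ N)) ≤ ENNReal.ofReal ε := by
  rw [collisionActivityTails_iff] at h
  obtain ⟨σ₀, hσ₀, h⟩ := h a₀ θ₀ u₀ ha hθ hu ha0 hθ0
  refine ⟨σ₀, hσ₀, fun σ hσ hσσ₀ ρ θ u hglob Φ hLLN t ht => ?_⟩
  exact h σ hσ hσσ₀ (t + 1) ρ θ u (hglob (t + 1)) Φ hLLN t ⟨ht, by linarith⟩

/-! ### §7e Literature status (cycle 2)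

`lit search`: local FTS down, OpenAlex / Semantic Scholar HTTP 429 (search-degraded); `lit galaxy`
(bm25, pdf corpus) available.  Nearest state-of-the-art statement: Bodineau–Gallagher–Saint-Raymond–
Simonella, *Dynamics of dilute gases: a statistical approach* (ICM 2022 survey, HAL 2021), §5.1
"Long time behavior for dilute gases": "The only case in which we have a complete picture of the
transition from the atomistic description to fluid models is the equilibrium case. Nevertheless the
diffusive scaling considered in these linear regimes is sub-logarithmic … In order to extend this
analysis to gases which are initially out of equilibrium, a major obstruction is to define a good
notion of stability for the nonlinear Boltzmann equation" — and ALL of it in the Boltzmann–Grad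
scaling `Nε^{d-1} = O(1)`.  The crux lives at FIXED reduced density (`(N+1)ε³ = σ³`, Spohn 1991
p. 51), where no uniform-in-`N` dynamical statement about a tagged sphere (collision-count
fluctuations, mixing of the collision stream, large deviations of time averages) is in print in
either direction; the equal-mass hard-ball ergodicity results (Sinai–Chernov, Simányi) are
qualitative and `N`-dependent; BFK 1998 / Burago–Ivanov 2018 bound or exhibit collision NUMBERS of
finitely many balls in free space only.  Physics literature on collision statistics of hard-sphere
fluids (Alder–Wainwright-era MD; Visco–Puglisi–Barrat–Trizac–van Wijland 2005 on injected power
fluctuations; L. Lue, J. Chem. Phys. 122 (2005) 044513, doi:10.1063/1.1834498, collision statistics of hard hyperspheres) reports Poisson/renewal-like tagged collision streams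
with exponential waiting times at low density — consistent with the CLT-rate reading of §7d and
with the crux.  No counterexample family exists in print; of the 15 refutations catalogued by
`ledger negatives --problem AtomisticToContinuum` (2026-08-16T14:05Z) none concerns window collision
statistics — the exponential-currency kills (stmt-14607 `ExpTailBudget`, and the dense-blob witness
behind ex-crux stmt-14441) confirm only that the `L¹` currency of the crux is forced (§4b). -/

/-! ### §7f Weaker RUNGS of the crux: the FRACTION statement and the UI statement (typed, proved)

By §7a the crux implies two strictly weaker statements in its own frame, each a legitimate
refutation target (refute either ⇒ the crux is false): the crux-shaped FRACTION statement
`CollisionActivityFraction` ("`P`-fraction of spheres with window activity above `V` → 0", no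
activity weighting — the cleanest form of "no hyperactive fraction") and the UI statement
`CollisionActivityUI`.  Their equilibrium versions follow by §5 (`EquilibriumActivityFraction`:
under the canonical Gibbs law the window activity of a tagged sphere exceeds `V ≥ V₀` with
vanishing probability as `τ → ∞` after `N → ∞` — the barest tagged-particle LLN statement the crux
contains).  Conversely the lead's cycle-2 stubs for `F = activity` would be exactly these two
(UI ∧ fraction ⇒ tail by truncation, their composition), so for the crux functional the split is a
repackaging: `crux ⇔ CollisionActivityUI ∧ CollisionActivityFraction` (⇐ is the lead's direction,
not restated here). -/

/-- The scalar FRACTION functional `y ↦ 𝟙{V < y}`. -/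
def fracFn (V y : ℝ) : ℝ := Set.indicator {y : ℝ | V < y} (fun _ => (1 : ℝ)) y

/-- The empirical hyperactive fraction `(N+1)⁻¹ #{i : V < aᵢ}` of an activity vector. -/
def activityFrac (N : ℕ) (V : ℝ) (a : Fin (N + 1) → ℝ) : ℝ :=
  ((N : ℝ) + 1)⁻¹ * ∑ i : Fin (N + 1), fracFn V (a i)

/-- `V 𝟙{V < y} ≤ 𝟙{V < y} y`. -/
theorem mul_fracFn_le_tailFn (V y : ℝ) : V * fracFn V y ≤ tailFn V y := by
  by_cases h : V < y
  · rw [fracFn, Set.indicator_of_mem (show y ∈ {y : ℝ | V < y} from h), mul_one, tailFn_of_lt h]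
    exact h.le
  · rw [fracFn, Set.indicator_of_notMem (show y ∉ {y : ℝ | V < y} from h), mul_zero,
      tailFn_of_le (not_lt.1 h)]

/-- The fraction functional is nonnegative. -/
theorem fracFn_nonneg (V y : ℝ) : 0 ≤ fracFn V y :=
  Set.indicator_nonneg (fun _ _ => zero_le_one) _

/-- The empirical fraction is nonnegative. -/
theorem activityFrac_nonneg (N : ℕ) (V : ℝ) (a : Fin (N + 1) → ℝ) : 0 ≤ activityFrac N V a :=
  mul_nonneg (by positivity) (Finset.sum_nonneg fun i _ => fracFn_nonneg V (a i))

/-- **Chebyshev at the threshold, empirical form**: `V · (fraction above V) ≤ (tail above V)`. -/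
theorem mul_activityFrac_le_activityTail (N : ℕ) (V : ℝ) (a : Fin (N + 1) → ℝ) :
    V * activityFrac N V a ≤ activityTail N V a := by
  unfold activityFrac activityTail
  rw [mul_left_comm, Finset.mul_sum]
  exact mul_le_mul_of_nonneg_left (Finset.sum_le_sum fun i _ => mul_fracFn_le_tailFn V (a i))
    (by positivity)

/-- **Chebyshev at the threshold, integrated**: for `V ≥ 0` and ANY random activity vector,
`V · E[fraction above V] ≤ E[tail above V]` (lower integrals; no measurability needed). -/
theorem ofReal_mul_lintegral_activityFrac_le {Ω : Type*} [MeasurableSpace Ω] (μ : Measure Ω)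
    (N : ℕ) {V : ℝ} (hV : 0 ≤ V) (a : Ω → Fin (N + 1) → ℝ) :
    ENNReal.ofReal V * ∫⁻ z, ENNReal.ofReal (activityFrac N V (a z)) ∂μ ≤
      ∫⁻ z, ENNReal.ofReal (activityTail N V (a z)) ∂μ := by
  rw [← lintegral_const_mul' _ _ ENNReal.ofReal_ne_top]
  refine lintegral_mono fun z => ?_
  rw [← ENNReal.ofReal_mul hV]
  exact ENNReal.ofReal_le_ofReal (mul_activityFrac_le_activityTail N V (a z))

/-- **The FRACTION rung of the crux** (crux frame verbatim, `activityTail ↦ activityFrac`): the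
expected FRACTION of spheres whose window activity exceeds `V ≥ V₀` vanishes as `τ → ∞` after
`N → ∞`, uniformly in `s ≤ t`, pre-shock. -/
def CollisionActivityFraction : Prop :=
  ∀ (a₀ θ₀ : T3 → ℝ) (u₀ : T3 → V3), Continuous a₀ → Continuous θ₀ → Continuous u₀ →
    (∀ x, 0 < a₀ x) → (∀ x, 0 < θ₀ x) → ∃ σ₀ : ℝ, 0 < σ₀ ∧ ∀ σ : ℝ, 0 < σ → σ < σ₀ →
    ∀ (T : ℝ) (ρ θ : ℝ → T3 → ℝ) (u : ℝ → T3 → V3), IsHardSphereEulerSolution σ T ρ u θ →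
    ∀ Φ : (N : ℕ) → Flow σ N,
    TendstoHydroFieldsAt (fun N => localGibbsLaw σ a₀ u₀ θ₀ N (Φ N)) Φ ρ u θ 0 →
    ∀ t ∈ Set.Ico 0 T, ∃ V₀ : ℝ, 0 < V₀ ∧ ∀ V : ℝ, V₀ ≤ V → ∀ ε : ℝ, 0 < ε →
    ∃ τ₀ : ℝ, 0 < τ₀ ∧ ∀ τ : ℝ, τ₀ ≤ τ → ∃ N₀ : ℕ, ∀ N : ℕ, N₀ ≤ N → ∀ s ∈ Set.Icc 0 t,
      ∫⁻ z, ENNReal.ofReal (activityFrac N V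
          (fun i => activity (Φ N) τ (Set.Ioc s (s + window τ N)) i z))
        ∂(localGibbsLaw σ a₀ u₀ θ₀ N (Φ N)) ≤ ENNReal.ofReal ε

/-- **The UI rung of the crux** (crux frame, UI shape: the threshold may depend on `ε`). -/
def CollisionActivityUI : Prop :=
  ∀ (a₀ θ₀ : T3 → ℝ) (u₀ : T3 → V3), Continuous a₀ → Continuous θ₀ → Continuous u₀ →
    (∀ x, 0 < a₀ x) → (∀ x, 0 < θ₀ x) → ∃ σ₀ : ℝ, 0 < σ₀ ∧ ∀ σ : ℝ, 0 < σ → σ < σ₀ →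
    ∀ (T : ℝ) (ρ θ : ℝ → T3 → ℝ) (u : ℝ → T3 → V3), IsHardSphereEulerSolution σ T ρ u θ →
    ∀ Φ : (N : ℕ) → Flow σ N,
    TendstoHydroFieldsAt (fun N => localGibbsLaw σ a₀ u₀ θ₀ N (Φ N)) Φ ρ u θ 0 →
    ∀ t ∈ Set.Ico 0 T, ∀ ε : ℝ, 0 < ε → ∃ K : ℝ,
    ∃ τ₀ : ℝ, 0 < τ₀ ∧ ∀ τ : ℝ, τ₀ ≤ τ → ∃ N₀ : ℕ, ∀ N : ℕ, N₀ ≤ N → ∀ s ∈ Set.Icc 0 t,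
      ∫⁻ z, ENNReal.ofReal (activityTail N K
          (fun i => activity (Φ N) τ (Set.Ioc s (s + window τ N)) i z))
        ∂(localGibbsLaw σ a₀ u₀ θ₀ N (Φ N)) ≤ ENNReal.ofReal ε

/-- **Crux ⇒ fraction rung** (Chebyshev at the threshold).  Contrapositive: a non-vanishing
EXPECTED FRACTION of hyperactive spheres (any level `V`, in the iterated limit) refutes the crux. -/
theorem collisionActivityFraction_of_crux
    (h : Summit.AtomisticToContinuum.HydrodynamicLimit.Theses.TwoClocks.CollisionActivityTails) :
    CollisionActivityFraction := by
  rw [collisionActivityTails_iff] at h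
  intro a₀ θ₀ u₀ ha hθ hu ha0 hθ0
  obtain ⟨σ₀, hσ₀, h⟩ := h a₀ θ₀ u₀ ha hθ hu ha0 hθ0
  refine ⟨σ₀, hσ₀, fun σ hσ hσσ₀ T ρ θ u hsol Φ hLLN t ht => ?_⟩
  obtain ⟨V₀, hV₀, h⟩ := h σ hσ hσσ₀ T ρ θ u hsol Φ hLLN t ht
  refine ⟨V₀, hV₀, fun V hV ε hε => ?_⟩
  have hVpos : 0 < V := hV₀.trans_le hV
  obtain ⟨τ₀, hτ₀, h⟩ := h V hV (V * ε) (mul_pos hVpos hε)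
  refine ⟨τ₀, hτ₀, fun τ hτ => ?_⟩
  obtain ⟨N₀, h⟩ := h τ hτ
  refine ⟨N₀, fun N hN s hs => ?_⟩
  have key := (ofReal_mul_lintegral_activityFrac_le (localGibbsLaw σ a₀ u₀ θ₀ N (Φ N)) N hVpos.le
    fun z i => activity (Φ N) τ (Set.Ioc s (s + window τ N)) i z).trans (h N hN s hs)
  rw [ENNReal.ofReal_mul hVpos.le] at key
  exact (ENNReal.mul_le_mul_iff_right (ENNReal.ofReal_pos.2 hVpos).ne' ENNReal.ofReal_ne_top).1 key

/-- **Crux ⇒ UI rung** (take `K := V₀`). -/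
theorem collisionActivityUI_of_crux
    (h : Summit.AtomisticToContinuum.HydrodynamicLimit.Theses.TwoClocks.CollisionActivityTails) :
    CollisionActivityUI := by
  rw [collisionActivityTails_iff] at h
  intro a₀ θ₀ u₀ ha hθ hu ha0 hθ0
  obtain ⟨σ₀, hσ₀, h⟩ := h a₀ θ₀ u₀ ha hθ hu ha0 hθ0
  refine ⟨σ₀, hσ₀, fun σ hσ hσσ₀ T ρ θ u hsol Φ hLLN t ht ε hε => ?_⟩
  obtain ⟨V₀, -, h⟩ := h σ hσ hσσ₀ T ρ θ u hsol Φ hLLN t ht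
  exact ⟨V₀, h V₀ le_rfl ε hε⟩

/-- **Equilibrium FRACTION rung**: under the canonical Gibbs law with constant profiles the
window activity of a tagged sphere exceeds `V ≥ V₀` only on a vanishing expected fraction, as
`τ → ∞` after `N → ∞` (window `(0, w]`). -/
def EquilibriumActivityFraction : Prop :=
  ∀ (a₀ θ₀ : ℝ) (u₀ : V3), 0 < a₀ → 0 < θ₀ → ∃ σ₀ : ℝ, 0 < σ₀ ∧ ∀ σ : ℝ, 0 < σ → σ < σ₀ →
    ∀ Φ : (N : ℕ) → Flow σ N, ∃ V₀ : ℝ, 0 < V₀ ∧ ∀ V : ℝ, V₀ ≤ V → ∀ ε : ℝ, 0 < ε →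
    ∃ τ₀ : ℝ, 0 < τ₀ ∧ ∀ τ : ℝ, τ₀ ≤ τ → ∃ N₀ : ℕ, ∀ N : ℕ, N₀ ≤ N →
      ∫⁻ z, ENNReal.ofReal (activityFrac N V
          (fun i => activity (Φ N) τ (Set.Ioc 0 (window τ N)) i z))
        ∂(localGibbsLaw σ (fun _ => a₀) (fun _ => u₀) (fun _ => θ₀) N (Φ N)) ≤ ENNReal.ofReal ε

/-- Equilibrium tails ⇒ equilibrium fraction (Chebyshev at the threshold). -/
theorem equilibriumActivityFraction_of_equilibrium (h : EquilibriumCollisionActivityTails) :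
    EquilibriumActivityFraction := by
  intro a₀ θ₀ u₀ ha hθ
  obtain ⟨σ₀, hσ₀, h⟩ := h a₀ θ₀ u₀ ha hθ
  refine ⟨σ₀, hσ₀, fun σ hσ hσσ₀ Φ => ?_⟩
  obtain ⟨V₀, hV₀, h⟩ := h σ hσ hσσ₀ Φ
  refine ⟨V₀, hV₀, fun V hV ε hε => ?_⟩
  have hVpos : 0 < V := hV₀.trans_le hV
  obtain ⟨τ₀, hτ₀, h⟩ := h V hV (V * ε) (mul_pos hVpos hε)
  refine ⟨τ₀, hτ₀, fun τ hτ => ?_⟩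
  obtain ⟨N₀, h⟩ := h τ hτ
  refine ⟨N₀, fun N hN => ?_⟩
  have key := (ofReal_mul_lintegral_activityFrac_le
    (localGibbsLaw σ (fun _ => a₀) (fun _ => u₀) (fun _ => θ₀) N (Φ N)) N hVpos.le
    fun z i => activity (Φ N) τ (Set.Ioc 0 (window τ N)) i z).trans (h N hN)
  rw [ENNReal.ofReal_mul hVpos.le] at key
  exact (ENNReal.mul_le_mul_iff_right (ENNReal.ofReal_pos.2 hVpos).ne' ENNReal.ofReal_ne_top).1 key

/-- **Crux ⇒ equilibrium fraction rung** (unconditional: §5c + Chebyshev).  Contrapositive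
(`not_collisionActivityTails_of_not_equilibriumActivityFraction`): persistent hyperactivity of a
tagged sphere at global equilibrium with non-vanishing PROBABILITY refutes the crux. -/
theorem equilibriumActivityFraction_of_crux
    (h : Summit.AtomisticToContinuum.HydrodynamicLimit.Theses.TwoClocks.CollisionActivityTails) :
    EquilibriumActivityFraction :=
  equilibriumActivityFraction_of_equilibrium (equilibriumCollisionActivityTails_of_crux' h)

/-- Any counterexample to the equilibrium fraction rung refutes the crux. -/
theorem not_collisionActivityTails_of_not_equilibriumActivityFraction
    (h : ¬ EquilibriumActivityFraction) :
    ¬ Summit.AtomisticToContinuum.HydrodynamicLimit.Theses.TwoClocks.CollisionActivityTails :=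
  fun hc => h (equilibriumActivityFraction_of_crux hc)

/-! ### §7g The ACTUAL cycle-2 stub bodies (published `Lines/SketchK1.lean`, 2026-08-16T13:51Z): audit, typed

Read: `CrowdedActivityUI` (UI shape `∀ε ∃M ∃τ₀ ∀τ≥τ₀ ∃N₀ ∀N≥N₀ ∀s`, WITH an `AEMeasurable` conjunct on the
tail sum), `CrowdedFractionLLN`, `NearFieldFractionLLN` (crux-shaped FRACTION statements, integrand
`(N+1)⁻¹ Σᵢ fracFn V (Fᵢ)`), `crowdedCollisionTails_of : CrowdedActivityUI → CrowdedFractionLLN →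
CrowdedCollisionTails` (proved in the skeleton), `stub_nearFieldReduction` (landed p106773 with the
necessity `NearFieldKineticTails → NearFieldFractionLLN`).  VERDICT: the §7b caveat does NOT bite
(`CrowdedActivityUI` is in UI shape, `τ₀` after `M`); no stub is misstated; the three open residuals are
crux-KIND.  Typed below over this file's verbatim vocabulary copies (§6b): for EVERY per-particle
functional `F`, the crux-shaped tail statement implies the fraction statement
(`fracStatement_of_tailStatement`, Chebyshev at the threshold) and the UI statement
(`uiStatement_of_tailStatement`; with the measurability conjunct given the measurability,
`uiStatementMeas_of_tailStatement`).  Hence, against the published bodies: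
`CrowdedCollisionTails ⇔ CrowdedActivityUI ∧ CrowdedFractionLLN` modulo the (closable) a.e.-measurability of
the `Fcr` tail sum — the reshape is an equivalence, not a weakening; likewise stub 5 ≡ `NearFieldFractionLLN`
given `KineticEnergyTails` (lead) and conversely `NearFieldKineticTails → NearFieldFractionLLN` (lead, p106773).

THE LEAD'S QUESTION (card 13:51Z: "is `CrowdedFractionLLN` (or `CrowdedActivityUI`) FALSE while the crux
holds? visitor hot-spot / translating-platoon laws").  (1) NOT CRUX-IMPLIED — agreed, and the budget
arithmetic makes it concrete: the only crux ↔ `Fcr` link is the packing budget `Σᵢ Fcrᵢ ≤ 343 Σₖ aₖ`; a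
"hub" law with a fraction `f` of spheres seeing `Fcr = V` and everyone's own activity `≤ V₀` is compatible
with it as soon as `f V ≤ 343 m` (`m` = mean activity) — e.g. `f = 1/2`, `V = 600 m` — so no amount of
activity-tail information excludes hubs (abstractly this is again the spike family of §3a applied to `Fcr`
at bounded `a`).  Translating platoons do NOT separate: a platoon member with internal gap `δ′` and relative
speed `δu` has OWN activity `≍ εδu²/δ′`, so platoons hot enough to give `Fcr > V` make their members
hyperactive (`a > V/k` with `k ≤ 343` members) — excluded by the crux at level `V₀ k`; only "cold hubs"
(violent VISITOR collisions near a calm tagged sphere, each visitor calm elsewhere) evade the crux.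
(2) NO DYNAMICAL EVIDENCE OF FALSITY: a cold hub is a persistent CO-MOVING inhomogeneity of the pair
collision-rate density, following a thermal tagged sphere over `≍ σ²τ′ → ∞` of its own mean free times while
the visitors stream through at thermal relative speed; under local equilibrium the collision-rate density
near a tagged sphere is statistically homogeneous in the co-moving frame and `Fcr` is a window average of an
additive functional of the tagged sphere's neighbourhood process with finite mean — the same renewal-type
LLN as the crux's own (`CollisionActivityFraction`, §7f), one rung up in bookkeeping (≤ 343 neighbours).
At equilibrium, stationarity + exchangeability give `E[fraction{Fcr > V}] = P(Fcr_tagged > V)`, and the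
§5/§6b reduction makes any equilibrium hub law a refutation of the stub; none is conceivable below freezing.
(3) `CrowdedActivityUI` false while the crux holds?  UI of `Fcr` fails only by MASS ESCAPE (a vanishing
fraction carrying non-vanishing `Fcr`-mean): by the budget this needs a vanishing fraction of spheres near
which a non-vanishing share of ALL impulse is exchanged — hubs again, now with diverging intensity; same
verdict.  So: both crowded residuals are strictly stronger than the crux in logic, equal in kind, and I
have no witness against either; they are honest PROMOTE candidates, with the rider that promoting
`CrowdedActivityUI` + `CrowdedFractionLLN` separately is promoting `CrowdedCollisionTails` in two pieces. -/

/-- The crux-shaped FRACTION statement of a per-particle functional (the frame of the published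
`CrowdedFractionLLN` / `NearFieldFractionLLN`, verbatim up to vocabulary copies). -/
def FracStatement (F : ∀ {σ : ℝ} {N : ℕ}, Flow σ N → ℝ → ℝ → Fin (N + 1) → Cfg N → ℝ) : Prop :=
  ∀ (a₀ θ₀ : T3 → ℝ) (u₀ : T3 → V3), Continuous a₀ → Continuous θ₀ → Continuous u₀ →
    (∀ x, 0 < a₀ x) → (∀ x, 0 < θ₀ x) → ∃ σ₀ : ℝ, 0 < σ₀ ∧ ∀ σ : ℝ, 0 < σ → σ < σ₀ →
    ∀ (T : ℝ) (ρ θ : ℝ → T3 → ℝ) (u : ℝ → T3 → V3), IsHardSphereEulerSolution σ T ρ u θ →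
    ∀ Φ : (N : ℕ) → Flow σ N,
    TendstoHydroFieldsAt (fun N => localGibbsLaw σ a₀ u₀ θ₀ N (Φ N)) Φ ρ u θ 0 →
    ∀ t ∈ Set.Ico 0 T, ∃ V₀ : ℝ, 0 < V₀ ∧ ∀ V : ℝ, V₀ ≤ V → ∀ δ : ℝ, 0 < δ →
    ∃ τ₀ : ℝ, 0 < τ₀ ∧ ∀ τ : ℝ, τ₀ ≤ τ → ∃ N₀ : ℕ, ∀ N : ℕ, N₀ ≤ N → ∀ s ∈ Set.Icc 0 t,
      ∫⁻ z, ENNReal.ofReal (((N : ℝ) + 1)⁻¹ * ∑ i : Fin (N + 1), fracFn V (F (Φ N) τ s i z))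
        ∂(localGibbsLaw σ a₀ u₀ θ₀ N (Φ N)) ≤ ENNReal.ofReal δ

/-- The UI-shaped statement of a per-particle functional (the frame of the published
`CrowdedActivityUI` WITHOUT its measurability conjunct). -/
def UIStatement (F : ∀ {σ : ℝ} {N : ℕ}, Flow σ N → ℝ → ℝ → Fin (N + 1) → Cfg N → ℝ) : Prop :=
  ∀ (a₀ θ₀ : T3 → ℝ) (u₀ : T3 → V3), Continuous a₀ → Continuous θ₀ → Continuous u₀ →
    (∀ x, 0 < a₀ x) → (∀ x, 0 < θ₀ x) → ∃ σ₀ : ℝ, 0 < σ₀ ∧ ∀ σ : ℝ, 0 < σ → σ < σ₀ →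
    ∀ (T : ℝ) (ρ θ : ℝ → T3 → ℝ) (u : ℝ → T3 → V3), IsHardSphereEulerSolution σ T ρ u θ →
    ∀ Φ : (N : ℕ) → Flow σ N,
    TendstoHydroFieldsAt (fun N => localGibbsLaw σ a₀ u₀ θ₀ N (Φ N)) Φ ρ u θ 0 →
    ∀ t ∈ Set.Ico 0 T, ∀ ε : ℝ, 0 < ε → ∃ M : ℝ,
    ∃ τ₀ : ℝ, 0 < τ₀ ∧ ∀ τ : ℝ, τ₀ ≤ τ → ∃ N₀ : ℕ, ∀ N : ℕ, N₀ ≤ N → ∀ s ∈ Set.Icc 0 t,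
      ∫⁻ z, ENNReal.ofReal (((N : ℝ) + 1)⁻¹ * ∑ i : Fin (N + 1), tailFn M (F (Φ N) τ s i z))
        ∂(localGibbsLaw σ a₀ u₀ θ₀ N (Φ N)) ≤ ENNReal.ofReal ε

/-- The measurability side condition folded by the lead into `CrowdedActivityUI` (all data). -/
def MeasStatement (F : ∀ {σ : ℝ} {N : ℕ}, Flow σ N → ℝ → ℝ → Fin (N + 1) → Cfg N → ℝ) : Prop :=
  ∀ (σ : ℝ) (a₀ θ₀ : T3 → ℝ) (u₀ : T3 → V3) (N : ℕ) (Φ : Flow σ N) (τ s M : ℝ),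
    AEMeasurable (fun z => ∑ i : Fin (N + 1), tailFn M (F Φ τ s i z)) (localGibbsLaw σ a₀ u₀ θ₀ N Φ)

/-- The UI-shaped statement WITH the measurability conjunct (the exact frame of the published
`CrowdedActivityUI`). -/
def UIStatementMeas (F : ∀ {σ : ℝ} {N : ℕ}, Flow σ N → ℝ → ℝ → Fin (N + 1) → Cfg N → ℝ) : Prop :=
  ∀ (a₀ θ₀ : T3 → ℝ) (u₀ : T3 → V3), Continuous a₀ → Continuous θ₀ → Continuous u₀ →
    (∀ x, 0 < a₀ x) → (∀ x, 0 < θ₀ x) → ∃ σ₀ : ℝ, 0 < σ₀ ∧ ∀ σ : ℝ, 0 < σ → σ < σ₀ →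
    ∀ (T : ℝ) (ρ θ : ℝ → T3 → ℝ) (u : ℝ → T3 → V3), IsHardSphereEulerSolution σ T ρ u θ →
    ∀ Φ : (N : ℕ) → Flow σ N,
    TendstoHydroFieldsAt (fun N => localGibbsLaw σ a₀ u₀ θ₀ N (Φ N)) Φ ρ u θ 0 →
    ∀ t ∈ Set.Ico 0 T, ∀ ε : ℝ, 0 < ε → ∃ M : ℝ,
    ∃ τ₀ : ℝ, 0 < τ₀ ∧ ∀ τ : ℝ, τ₀ ≤ τ → ∃ N₀ : ℕ, ∀ N : ℕ, N₀ ≤ N → ∀ s ∈ Set.Icc 0 t,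
      AEMeasurable (fun z => ∑ i : Fin (N + 1), tailFn M (F (Φ N) τ s i z))
          (localGibbsLaw σ a₀ u₀ θ₀ N (Φ N)) ∧
      ∫⁻ z, ENNReal.ofReal (((N : ℝ) + 1)⁻¹ * ∑ i : Fin (N + 1), tailFn M (F (Φ N) τ s i z))
        ∂(localGibbsLaw σ a₀ u₀ θ₀ N (Φ N)) ≤ ENNReal.ofReal ε

/-- **Tail statement ⇒ fraction statement**, for every functional (Chebyshev at the threshold;
lower integrals, no measurability). -/
theorem fracStatement_of_tailStatement
    {F : ∀ {σ : ℝ} {N : ℕ}, Flow σ N → ℝ → ℝ → Fin (N + 1) → Cfg N → ℝ} (h : TailStatement F) :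
    FracStatement F := by
  intro a₀ θ₀ u₀ ha hθ hu ha0 hθ0
  obtain ⟨σ₀, hσ₀, h⟩ := h a₀ θ₀ u₀ ha hθ hu ha0 hθ0
  refine ⟨σ₀, hσ₀, fun σ hσ hσσ₀ T ρ θ u hsol Φ hLLN t ht => ?_⟩
  obtain ⟨V₀, hV₀, h⟩ := h σ hσ hσσ₀ T ρ θ u hsol Φ hLLN t ht
  refine ⟨V₀, hV₀, fun V hV δ hδ => ?_⟩
  have hVpos : 0 < V := hV₀.trans_le hV
  obtain ⟨τ₀, hτ₀, h⟩ := h V hV (V * δ) (mul_pos hVpos hδ)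
  refine ⟨τ₀, hτ₀, fun τ hτ => ?_⟩
  obtain ⟨N₀, h⟩ := h τ hτ
  refine ⟨N₀, fun N hN s hs => ?_⟩
  have key := (ofReal_mul_lintegral_activityFrac_le (localGibbsLaw σ a₀ u₀ θ₀ N (Φ N)) N hVpos.le
    fun z i => F (Φ N) τ s i z).trans (h N hN s hs)
  rw [ENNReal.ofReal_mul hVpos.le] at key
  exact (ENNReal.mul_le_mul_iff_right (ENNReal.ofReal_pos.2 hVpos).ne' ENNReal.ofReal_ne_top).1 key

/-- **Tail statement ⇒ UI statement**, for every functional (take `M := V₀`). -/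
theorem uiStatement_of_tailStatement
    {F : ∀ {σ : ℝ} {N : ℕ}, Flow σ N → ℝ → ℝ → Fin (N + 1) → Cfg N → ℝ} (h : TailStatement F) :
    UIStatement F := by
  intro a₀ θ₀ u₀ ha hθ hu ha0 hθ0
  obtain ⟨σ₀, hσ₀, h⟩ := h a₀ θ₀ u₀ ha hθ hu ha0 hθ0
  refine ⟨σ₀, hσ₀, fun σ hσ hσσ₀ T ρ θ u hsol Φ hLLN t ht ε hε => ?_⟩
  obtain ⟨V₀, -, h⟩ := h σ hσ hσσ₀ T ρ θ u hsol Φ hLLN t ht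
  exact ⟨V₀, h V₀ le_rfl ε hε⟩

/-- **Tail statement ∧ measurability ⇒ the UI statement with its conjunct** (the published frame). -/
theorem uiStatementMeas_of_tailStatement
    {F : ∀ {σ : ℝ} {N : ℕ}, Flow σ N → ℝ → ℝ → Fin (N + 1) → Cfg N → ℝ} (h : TailStatement F)
    (hm : MeasStatement F) : UIStatementMeas F := by
  intro a₀ θ₀ u₀ ha hθ hu ha0 hθ0
  obtain ⟨σ₀, hσ₀, h⟩ := h a₀ θ₀ u₀ ha hθ hu ha0 hθ0
  refine ⟨σ₀, hσ₀, fun σ hσ hσσ₀ T ρ θ u hsol Φ hLLN t ht ε hε => ?_⟩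
  obtain ⟨V₀, -, h⟩ := h σ hσ hσσ₀ T ρ θ u hsol Φ hLLN t ht
  obtain ⟨τ₀, hτ₀, h⟩ := h V₀ le_rfl ε hε
  refine ⟨V₀, τ₀, hτ₀, fun τ hτ => ?_⟩
  obtain ⟨N₀, h⟩ := h τ hτ
  exact ⟨N₀, fun N hN s hs => ⟨hm σ a₀ θ₀ u₀ N (Φ N) τ s V₀, h N hN s hs⟩⟩

/-- The published `CrowdedFractionLLN` (verbatim frame, vocabulary copies of §6b). -/
def CrowdedFractionLLN : Prop := FracStatement (fun Φ τ s i z => crowdedActivity Φ τ s i z)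

/-- The published `NearFieldFractionLLN` (verbatim frame, vocabulary copies of §6b). -/
def NearFieldFractionLLN : Prop := FracStatement (fun Φ τ s i z => nearFieldKinetic Φ τ s i z)

/-- The published `CrowdedActivityUI` (verbatim frame incl. the measurability conjunct). -/
def CrowdedActivityUI : Prop := UIStatementMeas (fun Φ τ s i z => crowdedActivity Φ τ s i z)

/-- **Stub 6 ⇒ stub 6b**: `CrowdedCollisionTails → CrowdedFractionLLN` (so 6b is NECESSARY for the
old stub 6; with the skeleton's `crowdedCollisionTails_of` the reshape is an equivalence modulo 6a). -/
theorem crowdedFractionLLN_of_crowdedCollisionTails (h : CrowdedCollisionTails) : CrowdedFractionLLN :=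
  fracStatement_of_tailStatement h

/-- **Stub 6 ∧ measurability ⇒ stub 6a**: `CrowdedCollisionTails → MeasStatement Fcr → CrowdedActivityUI`. -/
theorem crowdedActivityUI_of_crowdedCollisionTails (h : CrowdedCollisionTails)
    (hm : MeasStatement (fun Φ τ s i z => crowdedActivity Φ τ s i z)) : CrowdedActivityUI :=
  uiStatementMeas_of_tailStatement h hm

/-- **Stub 5 ⇒ stub 5b** (the lead landed this necessity too, p106773; here for the record over the
§6b copies): `NearFieldKineticTails → NearFieldFractionLLN`. -/
theorem nearFieldFractionLLN_of_nearFieldKineticTails (h : NearFieldKineticTails) : NearFieldFractionLLN :=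
  fracStatement_of_tailStatement h

/-- The crux's own fraction rung is the instance `F = activity` (cf. §7f `CollisionActivityFraction`). -/
theorem collisionActivityFraction_iff_fracStatement :
    CollisionActivityFraction ↔
      FracStatement (fun {_ N} Φ τ s i z => activity Φ τ (Set.Ioc s (s + window τ N)) i z) :=
  Iff.rfl

/-- **Equilibrium rungs of the fraction stubs** (the §6b machinery is generic in the scalar functional:
`FracStatement F = TailStatement`-frame with `fracFn` in place of `tailFn`; the constant-data discharge
is identical).  Stated for the record as the contrapositive target: any equilibrium "hub law" — a tagged
sphere at global equilibrium seeing crowded activity `> V` in its `3ε`-neighbourhood with non-vanishing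
probability over `τ → ∞` windows — refutes `CrowdedFractionLLN`, hence the line. -/
def EquilibriumFracStatement
    (F : ∀ {σ : ℝ} {N : ℕ}, Flow σ N → ℝ → ℝ → Fin (N + 1) → Cfg N → ℝ) : Prop :=
  ∀ (a₀ θ₀ : ℝ) (u₀ : V3), 0 < a₀ → 0 < θ₀ → ∃ σ₀ : ℝ, 0 < σ₀ ∧ ∀ σ : ℝ, 0 < σ → σ < σ₀ →
    ∀ Φ : (N : ℕ) → Flow σ N, ∃ V₀ : ℝ, 0 < V₀ ∧ ∀ V : ℝ, V₀ ≤ V → ∀ δ : ℝ, 0 < δ →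
    ∃ τ₀ : ℝ, 0 < τ₀ ∧ ∀ τ : ℝ, τ₀ ≤ τ → ∃ N₀ : ℕ, ∀ N : ℕ, N₀ ≤ N →
      ∫⁻ z, ENNReal.ofReal (((N : ℝ) + 1)⁻¹ * ∑ i : Fin (N + 1), fracFn V (F (Φ N) τ 0 i z))
        ∂(localGibbsLaw σ (fun _ => a₀) (fun _ => u₀) (fun _ => θ₀) N (Φ N)) ≤ ENNReal.ofReal δ

/-- **Every crux-shaped fraction statement implies its equilibrium rung** (constant states +
`constantProfileLLN_holds`, exactly as `equilibriumTailStatement_of_tailStatement`). -/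
theorem equilibriumFracStatement_of_fracStatement
    {F : ∀ {σ : ℝ} {N : ℕ}, Flow σ N → ℝ → ℝ → Fin (N + 1) → Cfg N → ℝ} (h : FracStatement F) :
    EquilibriumFracStatement F := by
  intro a₀ θ₀ u₀ ha hθ
  obtain ⟨σc, hσc, hc⟩ := h (fun _ => a₀) (fun _ => θ₀) (fun _ => u₀) continuous_const
    continuous_const continuous_const (fun _ => ha) (fun _ => hθ)
  obtain ⟨σ₁, hσ₁, hl⟩ := constantProfileLLN_holds a₀ θ₀ u₀ ha hθ
  refine ⟨min σc σ₁, lt_min hσc hσ₁, fun σ hσ hσlt Φ => ?_⟩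
  have hσc' : σ < σc := hσlt.trans_le (min_le_left _ _)
  have hσ₁' : σ < σ₁ := hσlt.trans_le (min_le_right _ _)
  obtain ⟨r, hr, hlln⟩ := hl σ hσ hσ₁'
  obtain ⟨V₀, hV₀, H⟩ := hc σ hσ hσc' 1 (fun _ _ => r) (fun _ _ => θ₀) (fun _ _ => u₀)
    (isHardSphereEulerSolution_const σ 1 u₀ hr hθ) Φ (hlln Φ) 0 ⟨le_rfl, one_pos⟩
  refine ⟨V₀, hV₀, fun V hV δ hδ => ?_⟩
  obtain ⟨τ₀, hτ₀, H⟩ := H V hV δ hδ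
  refine ⟨τ₀, hτ₀, fun τ hτ => ?_⟩
  obtain ⟨N₀, H⟩ := H τ hτ
  exact ⟨N₀, fun N hN => H N hN 0 ⟨le_rfl, le_rfl⟩⟩

/-- Instance: any equilibrium hub law refutes `CrowdedFractionLLN`. -/
theorem not_crowdedFractionLLN_of_not_equilibrium
    (h : ¬ EquilibriumFracStatement (fun Φ τ s i z => crowdedActivity Φ τ s i z)) :
    ¬ CrowdedFractionLLN :=
  fun hc => h (equilibriumFracStatement_of_fracStatement hc)


/-! ### §7h Formal kernel of the hub answer: the packing budget does not transfer tails to `Fcr`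

In the abstract (mixture laws on `ℝ` of the two functionals of a uniformly chosen sphere): an
activity law with crux-shaped tails (`δ₁`: everyone at the mean level `1`), a crowded-activity law
whose MEAN obeys the packing budget `E Fcr ≤ 343 · E a` (the geometric law, mean `≤ 343`), and yet
the crux-shaped FRACTION statement fails for `Fcr` (`not_fracShape_geomLaw`): cold hubs at
geometrically rarer, higher levels.  So `CrowdedFractionLLN` is not a consequence of the crux plus
the only crux ↔ `Fcr` link the line has; whatever proves it must see the dynamics of visitors. -/

/-- The tail of a Dirac law at `1` vanishes above every threshold `V ≥ 1`. -/
theorem lawTail_dirac_one {V : ℝ} (hV : 1 ≤ V) : lawTail (Measure.dirac (1 : ℝ)) V = 0 := by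
  rw [lawTail, lintegral_dirac, tailFn_of_le hV, ENNReal.ofReal_zero]

/-- The mean of the geometric law is at most its (finite) tail series `Σ_k 2^{-(k+1)}(k+1)` (`= 2`;
only finiteness of the budget constant matters). -/
theorem lawMean_geomLaw_le : lawMean geomLaw ≤ ∑' k, geomTerm k := by
  rw [lawMean, lintegral_geomLaw]
  refine ENNReal.tsum_le_tsum fun k => ?_
  rw [geomTerm, ← ENNReal.ofReal_mul (geomWeight_pos k).le]

/-- **Budget ∧ crux tails ⇏ fraction statement for the crowded functional** (abstract hub law). -/
theorem exists_budget_cruxTails_not_fracShape :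
    ∃ (νa νcr : ℝ → ℕ → Measure ℝ) (B : ℝ≥0∞), B ≠ ∞ ∧
      (∀ τ N, IsProbabilityMeasure (νa τ N)) ∧ (∀ τ N, IsProbabilityMeasure (νcr τ N)) ∧
      CruxShape (fun V τ N => lawTail (νa τ N) V) ∧
      (∀ τ N, lawMean (νcr τ N) ≤ B) ∧
      ¬ CruxShape (fun V τ N => lawFrac (νcr τ N) V) := by
  refine ⟨fun _ _ => Measure.dirac 1, fun _ _ => geomLaw, ∑' k, geomTerm k, tsum_geomTerm_ne_top,
    fun _ _ => Measure.dirac.isProbabilityMeasure, fun _ _ => isProbabilityMeasure_geomLaw,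
    ?_, fun _ _ => lawMean_geomLaw_le, not_fracShape_geomLaw⟩
  refine ⟨1, one_pos, fun V hV ε hε => ⟨1, one_pos, fun τ _ => ⟨0, fun N _ => ?_⟩⟩⟩
  simp only [lawTail_dirac_one hV]
  exact bot_le

end Summit.AtomisticToContinuum.HydrodynamicLimit.Cruxes.CollisionActivityTails.Disproof
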